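import Literature.MathematicalPhysics.QuantumFieldTheory.Balaban1983to89.B9Thm37GlueT

/-!
# B9Thm37GlueSt — the first line of (3.88) in the PRINTED grouping over the star st(x), with the sizes of its
coefficients UNIFORM in the scale (sibling leaf of `B9Thm37Glue` v7 / `B9Thm37GlueT` v2; cell record D-pv21g6.1)

[B9] T. Bałaban, *Propagators for lattice gauge theories in a background field*, Commun. Math. Phys. **99** (1985)
389–434 [cite: Balaban1985BackgroundPropagators]; [4] = T. Bałaban, *Propagators and renormalization transformations
for lattice gauge theories. II*, Commun. Math. Phys. **96** (1984) 223–250 [cite: Balaban1984PropagatorsII].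

p. 390 (verbatim): *"Let us recall that R(U)X = UXU^{−1}."*; p. 400, (3.50) (verbatim, at U′ = 1 it is the formula
for the covariant Laplace operator (3.23) over the star of a point): *"Let us start with the covariant Laplace operator
Δ_U given by (3.23). We have (Δ_{U′U}λ)(x) = η^{−2}(2dλ(x) − Σ_{b∈st(x)} R((U′U)_b)λ(b₊)) = η^{−2}(2dλ(x) −
Σ_{μ=1}^d R(U′(x, x + ηe_μ))R(U(x, x + ηe_μ))λ(x + ηe_μ) − Σ_{μ=1}^d R(U(x, x − ηe_μ))R(U′(x, x − ηe_μ))λ(x − ηe_μ))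
= …"* — the star st(x) consists of ALL 2d bonds starting at x, positively AND negatively oriented; p. 409, first
display line of (3.88) (verbatim): *"Using (3.50) we get for x∈Δ(y), y∈Λ_j, (Δ′_ahλ)(x) = h(x)(Δ′_aλ)(x) −
Σ_{b∈st(x)}(∂h)(b)(Dλ)(b) + (Δh)(x)λ(x) + …"*; [4] p. 230, (2.40) (verbatim): *"(K(h_□)G′(□)h_□λ)(L^jηx) =
Σ_{b∈st(x)}(∂^{L^{−j}}h_□)(b)(∂^{L^{−j}}G′(□)h_□λ)(b) − (Δ^{L^{−j}}h_□)(x)(G′(□)h_□λ)(x) − …"*.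

THE POINT.  `B9Thm37Glue` v5 composed the two first-order Leibniz rules of the component model (D = `covD` (3.3),
D* = `covDT` (3.8), Δ_U = D*D (3.23)) into the second-order rule (L²) Δ_U∘M_h = M_h∘Δ_U + (−leibRemT h)∘D +
D*∘(leibRem h), grouping the bonds of st(x) by the MODULE's orientation: only the bonds with b₋ = x carry a
(∂h)(b)(Dλ)(b) term, and the zeroth-order operator D*∘leibRem h carries the rest — explicitly (D*((∂h)λ(b₋)))(x, i)
= Σ_{b₊=x} c(b)Σ_k R(U(b))_{ki}(∂h)(b)λ(b₋, k) − (Σ_{b₋=x} c(b)(∂h)(b))λ(x, i).  That splitting is a correct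
identity, but its first coefficient c(b)(∂h)(b) = O(η^{−1}(ML^jη)^{−1}) does NOT cancel, so the kernel hypotheses
`hdomL` / `hdomLT` of v5/v7/`B9Thm37GlueT` bounding D*∘leibRem h_□ against the entry-1 weight (L^{j″}η)² can only
be instantiated with row sums of order (L^jη)²·η^{−1}(ML^jη)^{−1} = L^jη/(Mη) = L^j/M — NOT small uniformly in the
scale j ≤ k (of order (Mη)^{−1} at the coarsest scales, where L^jη = O(1); cell record G-pv21g6-1: the kernel
content of those theorems is unaffected, their located smallness hypotheses are not uniformly inhabitable along
print's sizes).  PRINT groups over the whole star: for a negatively oriented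
bond b′ = ⟨x, x − ηe_μ⟩ one has U_{b′} = U(b)^{−1} for b = ⟨x − ηe_μ, x⟩, (∂h)(b′) = −(∂h)(b) and (Dλ)(b′) =
−R(U(b))^{−1}(Dλ)(b), so (∂h)(b′)(Dλ)(b′) = (∂h)(b)R(U(b))ᵀ(Dλ)(b) as soon as R(U(b)) is ORTHOGONAL (R(U)X =
UXU^{−1} preserves tr XY; in trace-orthonormal real components Σ_k R_{ki}R_{kj} = δ_{ij} — the model hypothesis
`hRm` below, NOT a quotation), and then
    Δ_U∘M_h = M_h∘Δ_U − (leibRemT h + leibRemIn h)∘D + M_{Δh},                                        (L²_st)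
with `leibRemIn h` (this file) the negatively-oriented half Σ_{b₊=x}(∂h)(b)Σ_k R(U(b))_{ki}(·)(b, k) of
Σ_{b∈st(x)}(∂h)(b)(·)(b) and `slap h` = Δh := D*Dh the lattice Laplace operator (3.23) at U = 1 applied to the
SCALAR h (`covLap_scalar_eq_slap`) — literally print's *"h(x)(Δ′_aλ)(x) − Σ_{b∈st(x)}(∂h)(b)(Dλ)(b) + (Δh)(x)λ(x)"*.
Now EVERY first-order coefficient is a (∂h)(b) = O((ML^jη)^{−1}) paired with Dλ (entry 2 of (3.42), weight
L^{j″}η: row sums O(M^{−1})) and the only zeroth-order coefficient is (Δh)(x) = O((ML^jη)^{−2}) paired with λ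
(entry 1, weight (L^{j″}η)²: row sums O(M^{−2})), uniformly in j — the sizes print uses at (3.89) / [4] (2.44)
(they remain NOT displayed in print and NOT asserted here: cell GAPS G-pv21g4-1 (i)).

* `leibRemIn`, `slap` (+ `_apply`), `covLap_scalar_eq_slap` (Δh = D*Dh at U = 1, one component);
* `covDT_comp_leibRem_st` — D*∘leibRem h = −(leibRemIn h)∘D + M_{Δh} for orthogonal R(U(b)) (kernel);
* `covLap_comp_mulOp_st` — (L²_st) (kernel); `covLapQ_mul_mulOp_st` — (3.88) first equality with Δ′_a = D*D + Q,
  Q = Q′*aQ′ ABSTRACT as in v7: K(h) = (leibRemT h + leibRemIn h)∘D + (−M_{Δh} + (M_hQ − QM_h));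
* `h388_lattice_st` — *"hence Δ′_aG′₀ = I − Σ_□K(h_□)G′_□h_□"* from the local inverse property and Σ_□h²_□ = 1
  (v7's `h388_lattice` with the regrouped K(h_□));
* `abs_leibRemT_le`, `abs_leibRemIn_le`, `leibRemSt_majorant` — the two-space majorant of the star operator
  leibRemT h + leibRemIn h from the located domination `hdomSt` of Σ_{b₋=x}|(∂h)(b)| + Σ_{b₊=x}Σ_k|(∂h)(b)R(U(b))_{ki}|
  block by block; `mulOp_majorant_diag` — the majorant of a multiplication operator from a located diagonal bound;
* `thm37_entry4_of_342_lattice_st` — v5's `thm37_entry4_of_342_lattice` ((3.88) in the printed abstract shape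
  `h388`) with the OUTER commutator Δ_U∘M_{h_□} regrouped by (L²_st): P′_□ = −(leibRemT h_□ + leibRemIn h_□)
  (kernel K′_{S,□}, row sums ≦ κ₃1_{S′_□} against L^{j″}η), C′_□ = M_{Δh_□} (K′_{Δ,□}, ≦ κ₄1_{S′_□} against (L^{j″}η)²);
* `thm37_entry4_of_342_lattice_of_387_st`, `thm37_entry2_of_342_lattice_of_387_st`,
  `thm37_entry1_of_342_lattice_of_387_st` — **Theorem 3.7 ⇒ entries 4, 2, 1 of (3.42) for G′ with (3.88) DERIVED in
  the printed grouping**: P_□ = leibRemT h_□ + leibRemIn h_□ (kernel K_{S,□}: `hdomSt`, row sums κ_S against L^{j″}η),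
  C_□ = −M_{Δh_□} + [M_{h_□}, Q] (kernels K_{Δ,□}: `hdiag`, κ_Δ, and K_Q: `hQ`, κ_Q, against (L^{j″}η)²); located
  smallness N′B₀e^{δ₀ρ}(κ_S + κ_Δ + κ_Q)c₁(α) < 1.

NOT ASSERTED (hypotheses): the orthogonality `hRm` of the matrices R(U(b)) in the chosen real components (the
model's identification of 𝔤-valued functions with trace-orthonormal components, not the paper's); Corollary 3.6
entries 1, 2, 4 of (3.42) for the G′_□ (`h342_1`, `h342_2`, `h342_4`); the LOCAL INVERSE property `hloc` and
Σ_□h²_□ = 1 `hsq` (p. 408); G′Δ′_a = I `hinv` (Δ′_a = D*D + Q); the averaging part Q = Q′*aQ′ of (3.24) ABSTRACT with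
the block majorant K_Q of [M_{h_□}, Q] a HYPOTHESIS (`hQ`; second display line of (3.88), size O(M^{−1})(L^jη)^{−2}
within blocks — not re-derived: no component model of Q′_j(U) in the lineage); the located dominations `hdomSt`
(K_S), `hdiag` (K_Δ), `hdh` (entry 2's K′) of the coefficients ∂h_□, Δh_□ of the partition of unity of [4] Sect. A, the
kernels' nonnegativity, localisation d(y, y″) ≦ ρ and row-sum bounds κ_S, κ_Δ, κ_Q, κ₄ (`hKS` … `hrowQ`, `hrowC'`) and
their SIZES O((ML^jη)^{−1}), O((ML^jη)^{−2}) (implicit in (1.118)/(2.36), NOT displayed in print; GAPS G-pv21g4-1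
(i)); in `thm37_entry4_of_342_lattice_st` moreover (3.88) itself in the printed abstract shape `h388` with abstract
P_□, C_□ and kernels K_{P,□}, K_{C,□} (as in v5); the partition data (|h_□| ≦ 1, supports S_□, S′_□, counts N, N′);
Lemma 2.1 of [4] (`h261`, `h263`); the geometry (d(y, y) = 0, d ≧ 0, L^{j″}η ≧ 0, (2.54)); the located smallness
(*"for M sufficiently large"*) and 0 ≦ (1 − α)δ₀ (the exponent loss of Lemma 2.1, [4] p. 234).  Entry 3 (G′∇*_U) in the printed grouping needs the
transposes of leibRemIn h_□ and M_{Δh_□} on top of `B9Thm37GlueT` and is NOT typed here.  This leaf imports the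
lineage modules only and modifies nothing.  Value: kernel-checked bookkeeping, NOT summit progress.
-/

namespace Literature.MathematicalPhysics.QuantumFieldTheory.Balaban1983to89.B9Thm37GlueSt

open Literature.MathematicalPhysics.QuantumFieldTheory.Balaban1983to89
open Finset B6RandomWalk B6RandomWalkHom B9Thm37Sum B9Thm34Ext B9Thm37Glue B9Thm37GlueT

variable {g : B9.Geometry} [Fintype g.Site] [DecidableEq g.Site] {R : ℝ} {H : Prop} {X Y St Cp Bd : Type}

section StGrouping

/-- **The negatively-oriented half of Σ_{b∈st(x)}(∂h)(b)(·)(b)** ((3.88) p. 409, with st(x) as in (3.50) p. 400):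
for a bond b with b₊ = x the reversed bond b′ = ⟨x, b₋⟩ ∈ st(x) contributes (∂h)(b′)(g)(b′) = (∂h)(b)R(U(b))ᵀ g(b)
(orthogonal R(U(b))), i.e. in components (leibRemIn h g)(x, i) = Σ_{b : b₊ = x} c(b)(h(b₊) − h(b₋))Σ_k R(U(b))_{ki}
g(b, k).  A bond-component → site-component operator (kernel definition; c, Rm arbitrary).
[cite: Balaban1985BackgroundPropagators, (3.50) p.400 + (3.88) p.409; Balaban1984PropagatorsII, (2.39)–(2.40) pp.229–230] -/
def leibRemIn [Fintype Bd] [Fintype Cp] [DecidableEq St] (src tgt : Bd → St) (c : Bd → ℝ)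
    (Rm : Bd → Cp → Cp → ℝ) (h : St → ℝ) : (Bd × Cp → ℝ) →ₗ[ℝ] (St × Cp → ℝ) where
  toFun f := fun p => ∑ b, (if tgt b = p.1 then c b * (h (tgt b) - h (src b)) else 0) * ∑ k, Rm b k p.2 * f (b, k)
  map_add' f f' := by
    funext p
    simp only [Pi.add_apply, mul_add, Finset.sum_add_distrib]
  map_smul' r f := by
    funext p
    simp only [Pi.smul_apply, smul_eq_mul, RingHom.id_apply, Finset.mul_sum]
    exact Finset.sum_congr rfl fun b _ => Finset.sum_congr rfl fun k _ => by ring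

/-- Unfolding equation of `leibRemIn`. [folklore] -/
theorem leibRemIn_apply [Fintype Bd] [Fintype Cp] [DecidableEq St] (src tgt : Bd → St) (c : Bd → ℝ)
    (Rm : Bd → Cp → Cp → ℝ) (h : St → ℝ) (f : Bd × Cp → ℝ) (p : St × Cp) :
    leibRemIn src tgt c Rm h f p =
      ∑ b, (if tgt b = p.1 then c b * (h (tgt b) - h (src b)) else 0) * ∑ k, Rm b k p.2 * f (b, k) :=
  rfl

/-- **The lattice Laplace operator of a SCALAR function** — (3.23) Δ^η = D^{η*}D^η at U = 1 on one component:
(Δh)(x) = Σ_{b : b₊ = x} c(b)²(h(b₊) − h(b₋)) − Σ_{b : b₋ = x} c(b)²(h(b₊) − h(b₋)) (for the η-lattice with c ≡ η^{−1}: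
η^{−2}Σ_μ(2h(x) − h(x + ηe_μ) − h(x − ηe_μ)), the POSITIVE operator of (3.50) at U = 1) — the coefficient "(Δh)(x)" of
(3.88) / "(Δ^{L^{−j}}h_□)(x)" of [4] (2.40). [cite: Balaban1985BackgroundPropagators, (3.23) p.394 + (3.50) p.400 + (3.88) p.409; Balaban1984PropagatorsII, (2.40) p.230] -/
def slap [Fintype Bd] [DecidableEq St] (src tgt : Bd → St) (c : Bd → ℝ) (h : St → ℝ) : St → ℝ :=
  fun x => ∑ b, ((if tgt b = x then c b * (c b * (h (tgt b) - h (src b))) else 0) -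
    (if src b = x then c b * (c b * (h (tgt b) - h (src b))) else 0))

/-- Unfolding equation of `slap`. [folklore] -/
theorem slap_apply [Fintype Bd] [DecidableEq St] (src tgt : Bd → St) (c : Bd → ℝ) (h : St → ℝ) (x : St) :
    slap src tgt c h x = ∑ b, ((if tgt b = x then c b * (c b * (h (tgt b) - h (src b))) else 0) -
      (if src b = x then c b * (c b * (h (tgt b) - h (src b))) else 0)) :=
  rfl

/-- CONSISTENCY: `slap h` IS the composite D*D of the component model (v3 `covD`, v4 `covDT`) at U = 1 (R ≡ 1) on a
single component, applied to h — i.e. (3.23) for the trivial configuration. [cite: Balaban1985BackgroundPropagators, (3.23) p.394 + (3.3) p.391 + (3.8) p.392] -/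
theorem covLap_scalar_eq_slap [Fintype Bd] [DecidableEq St] (src tgt : Bd → St) (c : Bd → ℝ) (h : St → ℝ) (x : St) :
    (covDT src tgt c (fun (_ : Bd) (_ _ : Unit) => (1 : ℝ)) ∘ₗ covD src tgt c (fun (_ : Bd) (_ _ : Unit) => (1 : ℝ)))
        (h ∘ Prod.fst) (x, ()) = slap src tgt c h x := by
  rw [LinearMap.comp_apply, covDT_apply, slap_apply]
  refine Finset.sum_congr rfl fun b _ => ?_
  simp only [covD_apply, Finset.univ_unique, Finset.sum_singleton, Function.comp_apply, one_mul]
  split_ifs <;> ring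

/-- **D*∘leibRem h REGROUPED over the star** (the algebra behind print's grouping of (3.88)): for ORTHOGONAL R(U(b))
(`hRm` : Σ_k R_{ki}R_{kj} = δ_{ij}), D*∘(leibRem h) = −(leibRemIn h)∘D + M_{Δh} — bond by bond, c(b)Σ_k R_{ki}(∂h)(b)
λ(b₋, k) = c(b)(∂h)(b)λ(x, i) − (∂h)(b)Σ_k R_{ki}(Dλ)(b, k) for b₊ = x by RᵀR = 1, and the zeroth-order terms
collect into (Δh)(x)λ(x, i).  Kernel identity (c, h arbitrary). [cite: Balaban1985BackgroundPropagators, (3.50) p.400 + (3.88) p.409] -/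
theorem covDT_comp_leibRem_st [Fintype Bd] [Fintype Cp] [DecidableEq St] [DecidableEq Cp] (src tgt : Bd → St) (c : Bd → ℝ)
    (Rm : Bd → Cp → Cp → ℝ) (h : St → ℝ) (hRm : ∀ b i j, ∑ k, Rm b k i * Rm b k j = if i = j then 1 else 0) :
    covDT src tgt c Rm ∘ₗ leibRem src tgt c h =
      -(leibRemIn src tgt c Rm h ∘ₗ covD src tgt c Rm) + mulOp (slap src tgt c h ∘ Prod.fst) := by
  apply LinearMap.ext
  intro f
  funext p
  rw [LinearMap.comp_apply, covDT_apply, LinearMap.add_apply, LinearMap.neg_apply, LinearMap.comp_apply,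
    Pi.add_apply, Pi.neg_apply, leibRemIn_apply, mulOp_apply, Function.comp_apply, slap_apply, Finset.sum_mul,
    ← Finset.sum_neg_distrib, ← Finset.sum_add_distrib]
  refine Finset.sum_congr rfl fun b _ => ?_
  simp only [leibRem_apply, covD_apply]
  -- the orthogonality of R(U(b)): Σ_k R_{ki} Σ_j R_{kj} f(b₊, j) = f(b₊, i)
  have key : ∑ k, Rm b k p.2 * ∑ j, Rm b k j * f (tgt b, j) = f (tgt b, p.2) := by
    calc ∑ k, Rm b k p.2 * ∑ j, Rm b k j * f (tgt b, j)
        = ∑ k, ∑ j, Rm b k p.2 * Rm b k j * f (tgt b, j) := by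
          refine Finset.sum_congr rfl fun k _ => ?_
          rw [Finset.mul_sum]
          exact Finset.sum_congr rfl fun j _ => by ring
      _ = ∑ j, (∑ k, Rm b k p.2 * Rm b k j) * f (tgt b, j) := by
          rw [Finset.sum_comm]
          exact Finset.sum_congr rfl fun j _ => by rw [Finset.sum_mul]
      _ = f (tgt b, p.2) := by
          simp_rw [hRm b p.2]
          simp only [ite_mul, one_mul, zero_mul, Finset.sum_ite_eq, Finset.mem_univ, if_true]
  set S1 := ∑ k, Rm b k p.2 * f (src b, k) with hS1
  have e1 : ∑ k, Rm b k p.2 * (c b * (h (tgt b) - h (src b)) * f (src b, k)) =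
      c b * (h (tgt b) - h (src b)) * S1 := by
    rw [hS1, Finset.mul_sum]
    exact Finset.sum_congr rfl fun k _ => by ring
  have e2 : ∑ k, Rm b k p.2 * (c b * (∑ j, Rm b k j * f (tgt b, j) - f (src b, k))) =
      c b * (f (tgt b, p.2) - S1) := by
    calc ∑ k, Rm b k p.2 * (c b * (∑ j, Rm b k j * f (tgt b, j) - f (src b, k)))
        = ∑ k, (c b * (Rm b k p.2 * ∑ j, Rm b k j * f (tgt b, j)) - c b * (Rm b k p.2 * f (src b, k))) :=
          Finset.sum_congr rfl fun k _ => by ring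
      _ = c b * ∑ k, Rm b k p.2 * ∑ j, Rm b k j * f (tgt b, j) - c b * S1 := by
          rw [Finset.sum_sub_distrib, ← Finset.mul_sum, ← Finset.mul_sum]
      _ = c b * (f (tgt b, p.2) - S1) := by rw [key, mul_sub]
  rw [e1, e2]
  by_cases ht : tgt b = p.1
  · by_cases hs : src b = p.1
    · rw [if_pos ht, if_pos hs, if_pos ht, if_pos ht, if_pos hs, ht, hs, Prod.mk.eta]
      ring
    · rw [if_pos ht, if_neg hs, if_pos ht, if_pos ht, if_neg hs, ht, Prod.mk.eta]
      ring
  · by_cases hs : src b = p.1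
    · rw [if_neg ht, if_pos hs, if_neg ht, if_neg ht, if_pos hs, hs, Prod.mk.eta]
      ring
    · rw [if_neg ht, if_neg hs, if_neg ht, if_neg ht, if_neg hs]
      ring

/-- **(L²_st) — the second-order Leibniz rule of Δ_U = D*D through M_h in the PRINTED grouping over st(x)**
(p. 409, first display line of (3.88), verbatim: *"(Δ′_ahλ)(x) = h(x)(Δ′_aλ)(x) − Σ_{b∈st(x)}(∂h)(b)(Dλ)(b) +
(Δh)(x)λ(x) + …"*; [4] (2.40)): for orthogonal R(U(b)),
Δ_U∘M_h = M_h∘Δ_U + ((−(leibRemT h + leibRemIn h))∘D + M_{Δh}) — the shape `hLeib` of v2's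
`thm37_leftEntry_of_342` at E = Δ_U with P′ = −(leibRemT h + leibRemIn h) (ALL of Σ_{b∈st(x)}(∂h)(b)(Dλ)(b)) and
C′ = M_{Δh} (ONLY the Laplacian of h).  From v5's `covLap_comp_mulOp` and `covDT_comp_leibRem_st`.
[cite: Balaban1985BackgroundPropagators, (3.23) p.394 + (3.50) p.400 + (3.88) p.409; Balaban1984PropagatorsII, (2.40) p.230] -/
theorem covLap_comp_mulOp_st [Fintype Bd] [Fintype Cp] [DecidableEq St] [DecidableEq Cp] (src tgt : Bd → St) (c : Bd → ℝ)
    (Rm : Bd → Cp → Cp → ℝ) (h : St → ℝ) (hRm : ∀ b i j, ∑ k, Rm b k i * Rm b k j = if i = j then 1 else 0) :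
    (covDT src tgt c Rm ∘ₗ covD src tgt c Rm) ∘ₗ mulOp (h ∘ Prod.fst) =
      mulOp (h ∘ Prod.fst) ∘ₗ (covDT src tgt c Rm ∘ₗ covD src tgt c Rm) +
        ((-(leibRemT src tgt c h + leibRemIn src tgt c Rm h)) ∘ₗ covD src tgt c Rm +
          mulOp (slap src tgt c h ∘ Prod.fst)) := by
  rw [covLap_comp_mulOp, covDT_comp_leibRem_st src tgt c Rm h hRm]
  simp only [neg_add, LinearMap.add_comp, LinearMap.neg_comp]
  abel

/-- **(3.88), first equality, in the lattice model and the PRINTED grouping** — Δ′_a∘M_h = M_h∘Δ′_a − K(h) for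
Δ′_a = D*D + Q (Q = the averaging part Q′*aQ′ of (3.24), ABSTRACT as in v7's `covLapQ_mul_mulOp`) and orthogonal
R(U(b)), with K(h) = (leibRemT h + leibRemIn h)∘D + (−M_{Δh} + (M_hQ − QM_h)): the D-part is print's
*"− Σ_{b∈st(x)}(∂h)(b)(Dλ)(b) + (Δh)(x)λ(x)"* read as −(K(h)λ)(x) term by term, the Q-part is the commutator (second
display line of (3.88), kept abstract). [cite: Balaban1985BackgroundPropagators, (3.88) p.409 + (3.23)–(3.24) p.394 + (3.50) p.400; Balaban1984PropagatorsII, (2.39)–(2.40) pp.229–230] -/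
theorem covLapQ_mul_mulOp_st [Fintype Bd] [Fintype Cp] [DecidableEq St] [DecidableEq Cp] (src tgt : Bd → St) (c : Bd → ℝ)
    (Rm : Bd → Cp → Cp → ℝ) (Qf : Module.End ℝ (St × Cp → ℝ)) (h : St → ℝ)
    (hRm : ∀ b i j, ∑ k, Rm b k i * Rm b k j = if i = j then 1 else 0) :
    (covDT src tgt c Rm ∘ₗ covD src tgt c Rm + Qf) * mulOp (h ∘ Prod.fst) =
      mulOp (h ∘ Prod.fst) * (covDT src tgt c Rm ∘ₗ covD src tgt c Rm + Qf) -
        ((leibRemT src tgt c h + leibRemIn src tgt c Rm h) ∘ₗ covD src tgt c Rm +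
          (-mulOp (slap src tgt c h ∘ Prod.fst) + (mulOp (h ∘ Prod.fst) * Qf - Qf * mulOp (h ∘ Prod.fst)))) := by
  have h5 := covLap_comp_mulOp_st src tgt c Rm h hRm
  simp only [Module.End.mul_eq_comp, LinearMap.add_comp, LinearMap.comp_add, neg_add, LinearMap.neg_comp] at h5 ⊢
  rw [h5]
  abel

/-- **"hence Δ′_aG′₀ = I − Σ_{□∈𝒟} K(h_□)G′_□h_□"** ((3.88), p. 409) **in the lattice model with K(h_□) in the
PRINTED grouping** — v7's `h388_lattice` with the regrouped first equality `covLapQ_mul_mulOp_st`: from the LOCAL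
INVERSE property h_□Δ′_aG′_□h_□ = h²_□ (`hloc`), Σ_□h²_□ = 1 (`hsq`, p. 408: *"We take the partition of unity {h_□}
defined at the end of Sect. A in [4]. We have Σ_{□∈𝒟} h²_□ = 1."*) and the ring identity `B9Thm37Sum.eq388_sum`;
P_□ = leibRemT h_□ + leibRemIn h_□, C_□ = −M_{Δh_□} + [M_{h_□}, Q]. [cite: Balaban1985BackgroundPropagators, (3.87)–(3.88) pp.408–409] -/
theorem h388_lattice_st [Fintype Bd] [Fintype Cp] [DecidableEq St] [DecidableEq Cp] {ι : Type} [Fintype ι] (src tgt : Bd → St)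
    (c : Bd → ℝ) (Rm : Bd → Cp → Cp → ℝ) (Qf : Module.End ℝ (St × Cp → ℝ)) (hs : ι → St → ℝ)
    (Gsq : ι → Module.End ℝ (St × Cp → ℝ)) (hRm : ∀ b i j, ∑ k, Rm b k i * Rm b k j = if i = j then 1 else 0)
    (hsq : ∀ x : St, ∑ i, hs i x ^ 2 = 1)
    (hloc : ∀ i, mulOp (hs i ∘ Prod.fst) * (covDT src tgt c Rm ∘ₗ covD src tgt c Rm + Qf) * Gsq i *
      mulOp (hs i ∘ Prod.fst) = mulOp (hs i ∘ Prod.fst) * mulOp (hs i ∘ Prod.fst)) :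
    (covDT src tgt c Rm ∘ₗ covD src tgt c Rm + Qf) * (∑ i, mulOp (hs i ∘ Prod.fst) * Gsq i * mulOp (hs i ∘ Prod.fst)) =
      1 - ∑ i, ((leibRemT src tgt c (hs i) + leibRemIn src tgt c Rm (hs i)) ∘ₗ covD src tgt c Rm +
        (-mulOp (slap src tgt c (hs i) ∘ Prod.fst) +
          (mulOp (hs i ∘ Prod.fst) * Qf - Qf * mulOp (hs i ∘ Prod.fst)))) * Gsq i * mulOp (hs i ∘ Prod.fst) :=
  eq388_sum (A := Module.End ℝ (St × Cp → ℝ)) (covDT src tgt c Rm ∘ₗ covD src tgt c Rm + Qf)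
    (fun i => mulOp (hs i ∘ Prod.fst)) Gsq
    (fun i => (leibRemT src tgt c (hs i) + leibRemIn src tgt c Rm (hs i)) ∘ₗ covD src tgt c Rm +
      (-mulOp (slap src tgt c (hs i) ∘ Prod.fst) + (mulOp (hs i ∘ Prod.fst) * Qf - Qf * mulOp (hs i ∘ Prod.fst))))
    (fun i => covLapQ_mul_mulOp_st src tgt c Rm Qf (hs i) hRm) hloc
    (sum_mulOp_sq (fun i => hs i ∘ Prod.fst) fun p => hsq p.1)

end StGrouping

section Majorants

/-- The pointwise content of v4's `leibRemT_majorant`: for μ supported in the bond block y′ with |μ| ≦ B,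
|(leibRemT h μ)(x, i)| ≦ (Σ_{b : b₋ = x, (b,i) in block y′}|c(b)(h(b₊) − h(b₋))|)·B. [folklore] -/
theorem abs_leibRemT_le [Fintype Bd] [DecidableEq St] (blkY : Bd × Cp → g.Site) (src tgt : Bd → St) (c : Bd → ℝ)
    (h : St → ℝ) {μ : Bd × Cp → ℝ} {y' : g.Site} {B : ℝ} (hμ : BlockSupp (g := toB6 g R H) blkY μ y' B)
    (p : St × Cp) :
    |leibRemT (Cp := Cp) src tgt c h μ p| ≤
      (∑ b ∈ Finset.univ.filter (fun b => src b = p.1 ∧ blkY (b, p.2) = y'), |c b * (h (tgt b) - h (src b))|) * B := by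
  rw [leibRemT_apply]
  calc |∑ b, (if src b = p.1 then c b * (h (tgt b) - h (src b)) else 0) * μ (b, p.2)|
      ≤ ∑ b, |(if src b = p.1 then c b * (h (tgt b) - h (src b)) else 0) * μ (b, p.2)| :=
        Finset.abs_sum_le_sum_abs _ _
    _ ≤ ∑ b, (if src b = p.1 ∧ blkY (b, p.2) = y' then |c b * (h (tgt b) - h (src b))| * B else 0) := by
        refine Finset.sum_le_sum fun b _ => ?_
        by_cases hs : src b = p.1
        · by_cases hy : blkY (b, p.2) = y'
          · rw [if_pos hs, if_pos ⟨hs, hy⟩, abs_mul]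
            exact mul_le_mul_of_nonneg_left (hμ.bound _ hy) (abs_nonneg _)
          · rw [hμ.off _ hy, mul_zero, abs_zero, if_neg (fun h2 => hy h2.2)]
        · rw [if_neg hs, zero_mul, abs_zero, if_neg (fun h2 => hs h2.1)]
    _ = (∑ b ∈ Finset.univ.filter (fun b => src b = p.1 ∧ blkY (b, p.2) = y'), |c b * (h (tgt b) - h (src b))|) * B := by
        rw [Finset.sum_filter, Finset.sum_mul]
        exact Finset.sum_congr rfl fun b _ => by split_ifs <;> simp

/-- The pointwise bound of the negatively-oriented half: for μ supported in the bond block y′ with |μ| ≦ B,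
|(leibRemIn h μ)(x, i)| ≦ (Σ_{b : b₊ = x}Σ_{k : (b,k) in block y′}|c(b)(h(b₊) − h(b₋))R(U(b))_{ki}|)·B. [folklore] -/
theorem abs_leibRemIn_le [Fintype Bd] [Fintype Cp] [DecidableEq St] (blkY : Bd × Cp → g.Site) (src tgt : Bd → St)
    (c : Bd → ℝ) (Rm : Bd → Cp → Cp → ℝ) (h : St → ℝ) {μ : Bd × Cp → ℝ} {y' : g.Site} {B : ℝ}
    (hμ : BlockSupp (g := toB6 g R H) blkY μ y' B) (p : St × Cp) :
    |leibRemIn src tgt c Rm h μ p| ≤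
      (∑ b ∈ Finset.univ.filter (fun b => tgt b = p.1),
          ∑ k ∈ Finset.univ.filter (fun k => blkY (b, k) = y'), |c b * (h (tgt b) - h (src b)) * Rm b k p.2|) * B := by
  rw [leibRemIn_apply]
  calc |∑ b, (if tgt b = p.1 then c b * (h (tgt b) - h (src b)) else 0) * ∑ k, Rm b k p.2 * μ (b, k)|
      ≤ ∑ b, |(if tgt b = p.1 then c b * (h (tgt b) - h (src b)) else 0) * ∑ k, Rm b k p.2 * μ (b, k)| :=
        Finset.abs_sum_le_sum_abs _ _
    _ ≤ ∑ b, (if tgt b = p.1 then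
          ∑ k, (if blkY (b, k) = y' then |c b * (h (tgt b) - h (src b)) * Rm b k p.2| * B else 0) else 0) := by
        refine Finset.sum_le_sum fun b _ => ?_
        by_cases ht : tgt b = p.1
        · rw [if_pos ht, if_pos ht, Finset.mul_sum]
          refine (Finset.abs_sum_le_sum_abs _ _).trans (Finset.sum_le_sum fun k _ => ?_)
          by_cases hk : blkY (b, k) = y'
          · rw [if_pos hk, show c b * (h (tgt b) - h (src b)) * (Rm b k p.2 * μ (b, k)) =
                (c b * (h (tgt b) - h (src b)) * Rm b k p.2) * μ (b, k) by ring, abs_mul]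
            exact mul_le_mul_of_nonneg_left (hμ.bound _ hk) (abs_nonneg _)
          · rw [if_neg hk, hμ.off _ hk, mul_zero, mul_zero, abs_zero]
        · rw [if_neg ht, if_neg ht, zero_mul, abs_zero]
    _ = (∑ b ∈ Finset.univ.filter (fun b => tgt b = p.1),
          ∑ k ∈ Finset.univ.filter (fun k => blkY (b, k) = y'), |c b * (h (tgt b) - h (src b)) * Rm b k p.2|) * B := by
        rw [Finset.sum_filter, Finset.sum_mul]
        refine Finset.sum_congr rfl fun b _ => ?_
        split_ifs
        · rw [Finset.sum_filter, Finset.sum_mul]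
          exact Finset.sum_congr rfl fun k _ => by split_ifs <;> simp
        · rw [zero_mul]

/-- **The two-space majorant of the star operator leibRemT h + leibRemIn h** (ALL of Σ_{b∈st(x)}(∂h)(b)(·)(b) of
(3.88)) from the located domination `hdomSt` of its explicit coefficients, site component by site component and
bond block by bond block: Σ_{b₋=x, (b,i) in block y″}|c(b)(∂̃h)(b)| + Σ_{b₊=x}Σ_{k : (b,k) in block y″}|c(b)(∂̃h)(b)
R(U(b))_{ki}| ≦ K(y, y″) for (x, i) in block y, (∂̃h)(b) = h(b₊) − h(b₋) (the SIZE of K — O((ML^jη)^{−1}) times the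
number of bonds and components at a site for the partition of unity of [4] Sect. A — is carried by K and is not
displayed in print). [cite: Balaban1985BackgroundPropagators, (3.88)–(3.89) p.409; Balaban1984PropagatorsII, (2.39)–(2.40) pp.229–230] -/
theorem leibRemSt_majorant [Fintype Bd] [Fintype Cp] [DecidableEq St] (blk : St × Cp → g.Site)
    (blkY : Bd × Cp → g.Site) (src tgt : Bd → St) (c : Bd → ℝ) (Rm : Bd → Cp → Cp → ℝ) (h : St → ℝ)
    (K : g.Site → g.Site → ℝ)
    (hdomSt : ∀ (p : St × Cp) (y' : g.Site),
      (∑ b ∈ Finset.univ.filter (fun b => src b = p.1 ∧ blkY (b, p.2) = y'), |c b * (h (tgt b) - h (src b))|) +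
        (∑ b ∈ Finset.univ.filter (fun b => tgt b = p.1),
          ∑ k ∈ Finset.univ.filter (fun k => blkY (b, k) = y'), |c b * (h (tgt b) - h (src b)) * Rm b k p.2|) ≤
        K (blk p) y') :
    HasMajorantHom (g := toB6 g R H) blkY blk (leibRemT src tgt c h + leibRemIn src tgt c Rm h) K := by
  intro y' μ B hμ p
  rw [LinearMap.add_apply, Pi.add_apply]
  refine (abs_add_le _ _).trans ?_
  refine (add_le_add (abs_leibRemT_le blkY src tgt c h hμ p) (abs_leibRemIn_le blkY src tgt c Rm h hμ p)).trans ?_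
  rw [← add_mul]
  exact mul_le_mul_of_nonneg_right (hdomSt p y') hμ.nonneg

/-- **The majorant of a multiplication operator from a located diagonal bound**: if 1_{x in block y″}|f(x)| ≦
K(y, y″) for x in block y, then M_f has the two-space majorant K (used for C′ = M_{Δh}: the SIZE |Δh_□| =
O((ML^jη)^{−2}) on the blocks near □ is carried by K). [folklore] -/
theorem mulOp_majorant_diag (blk : X → g.Site) (f : X → ℝ) (K : g.Site → g.Site → ℝ)
    (hdiag : ∀ (x : X) (y' : g.Site), (if blk x = y' then |f x| else 0) ≤ K (blk x) y') :
    HasMajorantHom (g := toB6 g R H) blk blk (mulOp f) K := by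
  intro y' μ B hμ x
  rw [mulOp_apply, abs_mul]
  have hK := hdiag x y'
  by_cases hx : blk x = y'
  · rw [if_pos hx] at hK
    exact mul_le_mul hK (hμ.bound _ hx) (abs_nonneg _) ((abs_nonneg _).trans hK)
  · rw [if_neg hx] at hK
    rw [hμ.off _ hx, abs_zero, mul_zero]
    exact mul_nonneg hK hμ.nonneg

end Majorants

section Entry421St

/-- **Theorem 3.7 ⇒ entry 4 of (3.42) for G′ = G′(U), Δ_U = D*D, with the OUTER commutator Δ_U∘M_{h_□} in the
PRINTED grouping** — v2's abstract `thm37_leftEntry_of_342` at E = Δ_U, Z = the site components, W ≡ 1, exactly as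
v5's `thm37_entry4_of_342_lattice` ((3.88) in the printed abstract shape `h388` with kernels K_{P,□}, K_{C,□} of row
sums ≦ κ₁1_{S′_□}, κ₂1_{S′_□}), but with `hLeib` supplied by (L²_st) (`covLap_comp_mulOp_st`, orthogonal R(U(b))):
P′_□ = −(leibRemT h_□ + leibRemIn h_□) with the majorant K′_{S,□} from `hdomSt` (row sums ≦ κ₃1_{S′_□} against
L^{j″}η — PAIRED WITH ENTRY 2, size O((ML^jη)^{−1})·L^jη = O(M^{−1}) for the partition of [4] Sect. A) and C′_□ =
M_{Δh_□} with K′_{Δ,□} from `hdiag` (row sums ≦ κ₄1_{S′_□} against (L^{j″}η)² — PAIRED WITH ENTRY 1, size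
O((ML^jη)^{−2})·(L^jη)² = O(M^{−2})); the sizes are NOT asserted.  Conclusion: |(Δ_UG′λ)(x)| ≦ B₀(N + N′e^{δ₀ρ}(κ₃ +
κ₄))c₁(α)(1 − N′θc₁(α))^{−1}e^{−(1−α)δ₀d(y,y′)}|λ|, θ = B₀e^{δ₀ρ}(κ₁ + κ₂), for x in the block of y, supp λ ⊂ Δ(y′).
[cite: Balaban1985BackgroundPropagators, (3.23) p.394 + (3.50) p.400 + Thm 3.7 (3.87)–(3.90) pp.408–410 + Thm 3.1 (3.42) p.397; Balaban1984PropagatorsII, Lemma 2.1 p.233, Prop 2.2 (2.67) p.234] -/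
theorem thm37_entry4_of_342_lattice_st [Fintype St] [DecidableEq St] [Fintype Cp] [DecidableEq Cp] [Fintype Bd]
    (blk : St × Cp → g.Site) (blkY : Bd × Cp → g.Site) (src tgt : Bd → St) (c : Bd → ℝ)
    (Rm : Bd → Cp → Cp → ℝ) (d : ℕ) (δ₀ α ρ B₀ κ₁ κ₂ κ₃ κ₄ N N' : ℝ) {ι : Type} [Fintype ι]
    (S S' : ι → Finset g.Site) (hs : ι → St → ℝ) (KP KC KS' KD' : ι → g.Site → g.Site → ℝ)
    {G' Δ : Module.End ℝ (St × Cp → ℝ)}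
    (hRm : ∀ b i j, ∑ k, Rm b k i * Rm b k j = if i = j then 1 else 0)
    (hB₀ : 0 ≤ B₀) (hδ₀ : 0 ≤ δ₀) (hκ : 0 ≤ κ₁ + κ₂) (hκ' : 0 ≤ κ₃ + κ₄) (hN : 0 ≤ N) (hN' : 0 ≤ N')
    (hαδ : 0 ≤ (1 - α) * δ₀)
    (htri : Triangle254 (toB6 g R H)) (hrefl : ∀ y : g.Site, g.dist y y = 0)
    (hdnn : ∀ y y' : g.Site, 0 ≤ g.dist y y') (hlen : ∀ y : g.Site, 0 ≤ g.len y)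
    (h261 : Ineq261 d (toB6 g R H) δ₀ α) (h263 : Ineq263 d (toB6 g R H) δ₀ α)
    (hsmall : N' * (B₀ * Real.exp (δ₀ * ρ) * (κ₁ + κ₂)) * B6.c1 d δ₀ α < 1)
    (hh : ∀ i x, |hs i x| ≤ 1) (hS : ∀ i (p : St × Cp), hs i p.1 ≠ 0 → blk p ∈ S i)
    (hcnt : ∀ a : g.Site, (∑ i, if a ∈ S i then (1 : ℝ) else 0) ≤ N)
    (hcnt' : ∀ a : g.Site, (∑ i, if a ∈ S' i then (1 : ℝ) else 0) ≤ N')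
    (hKP : ∀ i a b, 0 ≤ KP i a b) (hlocP : ∀ i a y'', KP i a y'' ≠ 0 → g.dist a y'' ≤ ρ)
    (hrowP : ∀ i (a : g.Site), ∑ y'' : g.Site, KP i a y'' * g.len y'' ≤ if a ∈ S' i then κ₁ else 0)
    (hKC : ∀ i a b, 0 ≤ KC i a b) (hlocC : ∀ i a y'', KC i a y'' ≠ 0 → g.dist a y'' ≤ ρ)
    (hrowC : ∀ i (a : g.Site), ∑ y'' : g.Site, KC i a y'' * g.len y'' ^ 2 ≤ if a ∈ S' i then κ₂ else 0)
    (hKS' : ∀ i a b, 0 ≤ KS' i a b) (hlocS' : ∀ i a y'', KS' i a y'' ≠ 0 → g.dist a y'' ≤ ρ)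
    (hrowS' : ∀ i (a : g.Site), ∑ y'' : g.Site, KS' i a y'' * g.len y'' ≤ if a ∈ S' i then κ₃ else 0)
    (hKD' : ∀ i a b, 0 ≤ KD' i a b) (hlocD' : ∀ i a y'', KD' i a y'' ≠ 0 → g.dist a y'' ≤ ρ)
    (hrowD' : ∀ i (a : g.Site), ∑ y'' : g.Site, KD' i a y'' * g.len y'' ^ 2 ≤ if a ∈ S' i then κ₄ else 0)
    (hdomSt : ∀ i (p : St × Cp) (y' : g.Site),
      (∑ b ∈ Finset.univ.filter (fun b => src b = p.1 ∧ blkY (b, p.2) = y'),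
          |c b * (hs i (tgt b) - hs i (src b))|) +
        (∑ b ∈ Finset.univ.filter (fun b => tgt b = p.1),
          ∑ k ∈ Finset.univ.filter (fun k => blkY (b, k) = y'),
            |c b * (hs i (tgt b) - hs i (src b)) * Rm b k p.2|) ≤ KS' i (blk p) y')
    (hdiag : ∀ i (p : St × Cp) (y' : g.Site),
      (if blk p = y' then |slap src tgt c (hs i) p.1| else 0) ≤ KD' i (blk p) y')
    {Gsq Cop : ι → Module.End ℝ (St × Cp → ℝ)} {P : ι → (Bd × Cp → ℝ) →ₗ[ℝ] (St × Cp → ℝ)}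
    (h342_1 : ∀ i, HasMajorant (g := toB6 g R H) blk (Gsq i)
      (fun a b => B₀ * g.len a ^ 2 * Real.exp (-(δ₀ * g.dist a b))))
    (h342_2 : ∀ i, HasMajorantHom (g := toB6 g R H) blk blkY (covD src tgt c Rm ∘ₗ Gsq i)
      (fun a b => B₀ * g.len a * Real.exp (-(δ₀ * g.dist a b))))
    (h342_4 : ∀ i, HasMajorantHom (g := toB6 g R H) blk blk ((covDT src tgt c Rm ∘ₗ covD src tgt c Rm) ∘ₗ Gsq i)
      (fun a b => B₀ * Real.exp (-(δ₀ * g.dist a b))))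
    (hP : ∀ i, HasMajorantHom (g := toB6 g R H) blkY blk (P i) (KP i))
    (hC : ∀ i, HasMajorant (g := toB6 g R H) blk (Cop i) (KC i))
    (hinv : G' * Δ = 1)
    (h388 : Δ * (∑ i, mulOp (hs i ∘ Prod.fst) * Gsq i * mulOp (hs i ∘ Prod.fst)) =
      1 - ∑ i, (P i ∘ₗ covD src tgt c Rm + Cop i) * Gsq i * mulOp (hs i ∘ Prod.fst)) :
    HasMajorantHom (g := toB6 g R H) blk blk ((covDT src tgt c Rm ∘ₗ covD src tgt c Rm) ∘ₗ G')
      (fun (a b : g.Site) => B₀ * (N + N' * Real.exp (δ₀ * ρ) * (κ₃ + κ₄)) * B6.c1 d δ₀ α *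
        (1 - N' * (B₀ * Real.exp (δ₀ * ρ) * (κ₁ + κ₂)) * B6.c1 d δ₀ α)⁻¹ *
        Real.exp (-((1 - α) * δ₀ * g.dist a b))) := by
  -- the structural inputs of `thm37_leftEntry_of_342` at E = Δ_U, supplied by the component model in the
  -- printed grouping (L²_st)
  have hLeib : ∀ i, (covDT src tgt c Rm ∘ₗ covD src tgt c Rm) ∘ₗ mulOp (hs i ∘ Prod.fst) =
      mulOp (hs i ∘ Prod.fst) ∘ₗ (covDT src tgt c Rm ∘ₗ covD src tgt c Rm) +
        ((-(leibRemT src tgt c (hs i) + leibRemIn src tgt c Rm (hs i))) ∘ₗ covD src tgt c Rm +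
          mulOp (slap src tgt c (hs i) ∘ Prod.fst)) :=
    fun i => covLap_comp_mulOp_st src tgt c Rm (hs i) hRm
  have hPL : ∀ i, HasMajorantHom (g := toB6 g R H) blkY blk
      (-(leibRemT src tgt c (hs i) + leibRemIn src tgt c Rm (hs i))) (KS' i) :=
    fun i => hasMajorantHom_neg blkY blk (leibRemSt_majorant blk blkY src tgt c Rm (hs i) (KS' i) (hdomSt i))
  have hCL : ∀ i, HasMajorantHom (g := toB6 g R H) blk blk (mulOp (slap src tgt c (hs i) ∘ Prod.fst)) (KD' i) :=
    fun i => mulOp_majorant_diag blk (slap src tgt c (hs i) ∘ Prod.fst) (KD' i) (hdiag i)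
  have hrowS'1 : ∀ i (a : g.Site), ∑ y'' : g.Site, KS' i a y'' * g.len y'' ≤
      if a ∈ S' i then κ₃ * (fun _ : g.Site => (1 : ℝ)) a else 0 := fun i a => by
    rw [mul_one]
    exact hrowS' i a
  have hrowD'1 : ∀ i (a : g.Site), ∑ y'' : g.Site, KD' i a y'' * g.len y'' ^ 2 ≤
      if a ∈ S' i then κ₄ * (fun _ : g.Site => (1 : ℝ)) a else 0 := fun i a => by
    rw [mul_one]
    exact hrowD' i a
  have h342_E : ∀ i, HasMajorantHom (g := toB6 g R H) blk blk
      ((covDT src tgt c Rm ∘ₗ covD src tgt c Rm) ∘ₗ Gsq i)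
      (fun a b => B₀ * (fun _ : g.Site => (1 : ℝ)) a * Real.exp (-(δ₀ * g.dist a b))) :=
    fun i => hasMajorantHom_mono (g := toB6 g R H) blk blk (h342_4 i) fun (a b : g.Site) => le_of_eq (by ring)
  have hmain := thm37_leftEntry_of_342 (R := R) (H := H) blk blkY blk d δ₀ α ρ B₀ κ₁ κ₂ κ₃ κ₄ N N'
    (fun _ => (1 : ℝ)) S S' (fun i => hs i ∘ Prod.fst) (fun i => hs i ∘ Prod.fst) KP KC KS' KD' hB₀ hδ₀ hκ hκ' hN
    hN' (fun _ => zero_le_one) hαδ htri hrefl hdnn hlen h261 h263 hsmall (fun i p => hh i p.1) (fun i p => hh i p.1)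
    hS hcnt hcnt' hKP hlocP hrowP hKC hlocC hrowC hKS' hlocS' hrowS'1 hKD' hlocD' hrowD'1
    (PL := fun i => -(leibRemT src tgt c (hs i) + leibRemIn src tgt c Rm (hs i)))
    (CL := fun i => mulOp (slap src tgt c (hs i) ∘ Prod.fst))
    h342_1 h342_2 h342_E hP hC hPL hCL hLeib hinv h388
  refine hasMajorantHom_mono (g := toB6 g R H) blk blk hmain fun (a b : g.Site) => le_of_eq ?_
  simp only [mul_one]

/-- **Theorem 3.7 ⇒ entry 4 of (3.42) for G′ = G′(U) with (3.88) DERIVED in the PRINTED grouping** —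
`thm37_entry4_of_342_lattice_st` with `h388` DISCHARGED by `h388_lattice_st` (Δ′_a = D*D + Q, Q = Q′*aQ′ of (3.24)
abstract with the commutator majorant `hQ` of kernel K_Q, row sums ≦ κ_Q1_{S′_□} against (L^{j″}η)², as in v7): the
SAME star kernel K_{S,□} (`hdomSt`, row sums ≦ κ_S1_{S′_□} against L^{j″}η) serves P_□ = leibRemT h_□ + leibRemIn h_□
in (3.88) and the outer P′_□ = −P_□, and the SAME diagonal kernel K_{Δ,□} (`hdiag`, ≦ κ_Δ1_{S′_□} against (L^{j″}η)²)
serves −M_{Δh_□} ⊆ C_□ and C′_□ = M_{Δh_□}.  Located smallness N′B₀e^{δ₀ρ}(κ_S + κ_Δ + κ_Q)c₁(α) < 1 (*"for M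
sufficiently large"*: κ_S = O(M^{−1}), κ_Δ = O(M^{−2}), κ_Q = O(M^{−1}) are print's sizes, NOT asserted); conclusion
B₀(N + N′e^{δ₀ρ}(κ_S + κ_Δ))c₁(α)(1 − N′B₀e^{δ₀ρ}(κ_S + κ_Δ + κ_Q)c₁(α))^{−1}e^{−(1−α)δ₀d(y,y′)} — entry 4 of (3.42)
for G′, weight 1. [cite: Balaban1985BackgroundPropagators, Thm 3.7 (3.87)–(3.90) pp.408–410 + (3.42) p.397 + (3.23)–(3.24) p.394 + (3.50) p.400; Balaban1984PropagatorsII, Prop 2.2 (2.67) p.234] -/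
theorem thm37_entry4_of_342_lattice_of_387_st [Fintype St] [DecidableEq St] [Fintype Cp] [DecidableEq Cp]
    [Fintype Bd] (blk : St × Cp → g.Site) (blkY : Bd × Cp → g.Site) (src tgt : Bd → St) (c : Bd → ℝ)
    (Rm : Bd → Cp → Cp → ℝ) (Qf : Module.End ℝ (St × Cp → ℝ)) (d : ℕ) (δ₀ α ρ B₀ κS κΔ κQ N N' : ℝ) {ι : Type}
    [Fintype ι] (S S' : ι → Finset g.Site) (hs : ι → St → ℝ) (KS KD KQ : ι → g.Site → g.Site → ℝ)
    {G' : Module.End ℝ (St × Cp → ℝ)}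
    (hRm : ∀ b i j, ∑ k, Rm b k i * Rm b k j = if i = j then 1 else 0)
    (hB₀ : 0 ≤ B₀) (hδ₀ : 0 ≤ δ₀) (hκS : 0 ≤ κS) (hκΔ : 0 ≤ κΔ) (hκQ : 0 ≤ κQ) (hN : 0 ≤ N) (hN' : 0 ≤ N')
    (hαδ : 0 ≤ (1 - α) * δ₀)
    (htri : Triangle254 (toB6 g R H)) (hrefl : ∀ y : g.Site, g.dist y y = 0)
    (hdnn : ∀ y y' : g.Site, 0 ≤ g.dist y y') (hlen : ∀ y : g.Site, 0 ≤ g.len y)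
    (h261 : Ineq261 d (toB6 g R H) δ₀ α) (h263 : Ineq263 d (toB6 g R H) δ₀ α)
    (hsmall : N' * (B₀ * Real.exp (δ₀ * ρ) * (κS + (κΔ + κQ))) * B6.c1 d δ₀ α < 1)
    (hh : ∀ i x, |hs i x| ≤ 1) (hS : ∀ i (p : St × Cp), hs i p.1 ≠ 0 → blk p ∈ S i)
    (hcnt : ∀ a : g.Site, (∑ i, if a ∈ S i then (1 : ℝ) else 0) ≤ N)
    (hcnt' : ∀ a : g.Site, (∑ i, if a ∈ S' i then (1 : ℝ) else 0) ≤ N')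
    (hKS : ∀ i a b, 0 ≤ KS i a b) (hlocS : ∀ i a y'', KS i a y'' ≠ 0 → g.dist a y'' ≤ ρ)
    (hrowS : ∀ i (a : g.Site), ∑ y'' : g.Site, KS i a y'' * g.len y'' ≤ if a ∈ S' i then κS else 0)
    (hKD : ∀ i a b, 0 ≤ KD i a b) (hlocD : ∀ i a y'', KD i a y'' ≠ 0 → g.dist a y'' ≤ ρ)
    (hrowD : ∀ i (a : g.Site), ∑ y'' : g.Site, KD i a y'' * g.len y'' ^ 2 ≤ if a ∈ S' i then κΔ else 0)
    (hKQ : ∀ i a b, 0 ≤ KQ i a b) (hlocQ : ∀ i a y'', KQ i a y'' ≠ 0 → g.dist a y'' ≤ ρ)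
    (hrowQ : ∀ i (a : g.Site), ∑ y'' : g.Site, KQ i a y'' * g.len y'' ^ 2 ≤ if a ∈ S' i then κQ else 0)
    (hdomSt : ∀ i (p : St × Cp) (y' : g.Site),
      (∑ b ∈ Finset.univ.filter (fun b => src b = p.1 ∧ blkY (b, p.2) = y'),
          |c b * (hs i (tgt b) - hs i (src b))|) +
        (∑ b ∈ Finset.univ.filter (fun b => tgt b = p.1),
          ∑ k ∈ Finset.univ.filter (fun k => blkY (b, k) = y'),
            |c b * (hs i (tgt b) - hs i (src b)) * Rm b k p.2|) ≤ KS i (blk p) y')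
    (hdiag : ∀ i (p : St × Cp) (y' : g.Site),
      (if blk p = y' then |slap src tgt c (hs i) p.1| else 0) ≤ KD i (blk p) y')
    (hsq : ∀ x : St, ∑ i, hs i x ^ 2 = 1)
    {Gsq : ι → Module.End ℝ (St × Cp → ℝ)}
    (h342_1 : ∀ i, HasMajorant (g := toB6 g R H) blk (Gsq i)
      (fun a b => B₀ * g.len a ^ 2 * Real.exp (-(δ₀ * g.dist a b))))
    (h342_2 : ∀ i, HasMajorantHom (g := toB6 g R H) blk blkY (covD src tgt c Rm ∘ₗ Gsq i)
      (fun a b => B₀ * g.len a * Real.exp (-(δ₀ * g.dist a b))))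
    (h342_4 : ∀ i, HasMajorantHom (g := toB6 g R H) blk blk ((covDT src tgt c Rm ∘ₗ covD src tgt c Rm) ∘ₗ Gsq i)
      (fun a b => B₀ * Real.exp (-(δ₀ * g.dist a b))))
    (hQ : ∀ i, HasMajorant (g := toB6 g R H) blk (mulOp (hs i ∘ Prod.fst) * Qf - Qf * mulOp (hs i ∘ Prod.fst)) (KQ i))
    (hloc : ∀ i, mulOp (hs i ∘ Prod.fst) * (covDT src tgt c Rm ∘ₗ covD src tgt c Rm + Qf) * Gsq i *
      mulOp (hs i ∘ Prod.fst) = mulOp (hs i ∘ Prod.fst) * mulOp (hs i ∘ Prod.fst))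
    (hinv : G' * (covDT src tgt c Rm ∘ₗ covD src tgt c Rm + Qf) = 1) :
    HasMajorantHom (g := toB6 g R H) blk blk ((covDT src tgt c Rm ∘ₗ covD src tgt c Rm) ∘ₗ G')
      (fun (a b : g.Site) => B₀ * (N + N' * Real.exp (δ₀ * ρ) * (κS + κΔ)) * B6.c1 d δ₀ α *
        (1 - N' * (B₀ * Real.exp (δ₀ * ρ) * (κS + (κΔ + κQ))) * B6.c1 d δ₀ α)⁻¹ *
        Real.exp (-((1 - α) * δ₀ * g.dist a b))) := by
  have hP : ∀ i, HasMajorantHom (g := toB6 g R H) blkY blk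
      (leibRemT src tgt c (hs i) + leibRemIn src tgt c Rm (hs i)) (KS i) :=
    fun i => leibRemSt_majorant blk blkY src tgt c Rm (hs i) (KS i) (hdomSt i)
  have hC : ∀ i, HasMajorant (g := toB6 g R H) blk
      (-mulOp (slap src tgt c (hs i) ∘ Prod.fst) + (mulOp (hs i ∘ Prod.fst) * Qf - Qf * mulOp (hs i ∘ Prod.fst)))
      (fun a b => KD i a b + KQ i a b) := fun i =>
    (hasMajorantHom_iff (g := toB6 g R H) blk _ _).mp
      (hasMajorantHom_add (g := toB6 g R H) blk blk
        (hasMajorantHom_neg blk blk (mulOp_majorant_diag blk (slap src tgt c (hs i) ∘ Prod.fst) (KD i) (hdiag i)))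
        ((hasMajorantHom_iff (g := toB6 g R H) blk _ _).mpr (hQ i)))
  have hKC : ∀ i a b, 0 ≤ KD i a b + KQ i a b := fun i a b => add_nonneg (hKD i a b) (hKQ i a b)
  have hlocC : ∀ i a y'', KD i a y'' + KQ i a y'' ≠ 0 → g.dist a y'' ≤ ρ := fun i a y'' hne => by
    by_cases h1 : KD i a y'' = 0
    · rw [h1, zero_add] at hne
      exact hlocQ i a y'' hne
    · exact hlocD i a y'' h1
  have hrowC : ∀ i (a : g.Site), ∑ y'' : g.Site, (KD i a y'' + KQ i a y'') * g.len y'' ^ 2 ≤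
      if a ∈ S' i then κΔ + κQ else 0 := fun i a => rowSum_add_le a (hrowD i a) (hrowQ i a)
  have hκ : 0 ≤ κS + (κΔ + κQ) := by linarith
  have hκ' : 0 ≤ κS + κΔ := by linarith
  exact thm37_entry4_of_342_lattice_st (P := fun i => leibRemT src tgt c (hs i) + leibRemIn src tgt c Rm (hs i))
    (Cop := fun i => -mulOp (slap src tgt c (hs i) ∘ Prod.fst) +
      (mulOp (hs i ∘ Prod.fst) * Qf - Qf * mulOp (hs i ∘ Prod.fst)))
    blk blkY src tgt c Rm d δ₀ α ρ B₀ κS (κΔ + κQ) κS κΔ N N' S S' hs KS (fun i a b => KD i a b + KQ i a b) KS KD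
    hRm hB₀ hδ₀ hκ hκ' hN hN' hαδ htri hrefl hdnn hlen h261 h263 hsmall hh hS hcnt hcnt' hKS hlocS hrowS hKC hlocC
    hrowC hKS hlocS hrowS hKD hlocD hrowD hdomSt hdiag h342_1 h342_2 h342_4 hP hC hinv
    (h388_lattice_st src tgt c Rm Qf hs Gsq hRm hsq hloc)

/-- **Theorem 3.7 ⇒ entry 2 of (3.42) for G′ = G′(U) with (3.88) DERIVED in the PRINTED grouping** — v3's
`thm37_entry2_of_342_lattice` with `h388` DISCHARGED by `h388_lattice_st` (P_□ = leibRemT h_□ + leibRemIn h_□ with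
the star kernel K_{S,□} of `hdomSt` (κ_S against L^{j″}η); C_□ = −M_{Δh_□} + [M_{h_□}, Q] with K_{Δ,□} of `hdiag` (κ_Δ)
and K_Q of `hQ` (κ_Q) against (L^{j″}η)²); every other input as in v3 (Cor. 3.6 entries 1, 2 for the G′_□, the
entrywise kernel `hdh` (κ₄) of the first-order Leibniz remainder of D through M_{h_□}, Lemma 2.1 of [4], counts,
located smallness N′B₀e^{δ₀ρ}(κ_S + κ_Δ + κ_Q)c₁(α) < 1).
[cite: Balaban1985BackgroundPropagators, Thm 3.7 (3.87)–(3.90) pp.408–410 + (3.42) p.397 + (3.3) pp.390–391 + (3.50) p.400; Balaban1984PropagatorsII, Prop 2.2 (2.67) p.234] -/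
theorem thm37_entry2_of_342_lattice_of_387_st [Fintype St] [DecidableEq St] [Fintype Bd] [DecidableEq Bd]
    [Fintype Cp] [DecidableEq Cp]
    (src tgt : Bd → St) (c : Bd → ℝ) (Rm : Bd → Cp → Cp → ℝ) (Qf : Module.End ℝ (St × Cp → ℝ))
    (blk : St × Cp → g.Site) (blkY : Bd × Cp → g.Site) (d : ℕ) (δ₀ α ρ B₀ κS κΔ κQ κ₄ N N' : ℝ) {ι : Type}
    [Fintype ι] (S S' : ι → Finset g.Site) (hs : ι → St → ℝ) (KS KD KQ KC' : ι → g.Site → g.Site → ℝ)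
    {G' : Module.End ℝ (St × Cp → ℝ)}
    (hRm : ∀ b i j, ∑ k, Rm b k i * Rm b k j = if i = j then 1 else 0)
    (hB₀ : 0 ≤ B₀) (hδ₀ : 0 ≤ δ₀) (hκS : 0 ≤ κS) (hκΔ : 0 ≤ κΔ) (hκQ : 0 ≤ κQ) (hκ₄ : 0 ≤ κ₄) (hN : 0 ≤ N)
    (hN' : 0 ≤ N') (hαδ : 0 ≤ (1 - α) * δ₀)
    (htri : Triangle254 (toB6 g R H)) (hrefl : ∀ y : g.Site, g.dist y y = 0)
    (hdnn : ∀ y y' : g.Site, 0 ≤ g.dist y y') (hlen : ∀ y : g.Site, 0 ≤ g.len y)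
    (h261 : Ineq261 d (toB6 g R H) δ₀ α) (h263 : Ineq263 d (toB6 g R H) δ₀ α)
    (hsmall : N' * (B₀ * Real.exp (δ₀ * ρ) * (κS + (κΔ + κQ))) * B6.c1 d δ₀ α < 1)
    (hh : ∀ i x, |hs i x| ≤ 1) (hSY : ∀ i (v : Bd × Cp), hs i (tgt v.1) ≠ 0 → blkY v ∈ S i)
    (hcnt : ∀ a : g.Site, (∑ i, if a ∈ S i then (1 : ℝ) else 0) ≤ N)
    (hcnt' : ∀ a : g.Site, (∑ i, if a ∈ S' i then (1 : ℝ) else 0) ≤ N')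
    (hKS : ∀ i a b, 0 ≤ KS i a b) (hlocS : ∀ i a y'', KS i a y'' ≠ 0 → g.dist a y'' ≤ ρ)
    (hrowS : ∀ i (a : g.Site), ∑ y'' : g.Site, KS i a y'' * g.len y'' ≤ if a ∈ S' i then κS else 0)
    (hKD : ∀ i a b, 0 ≤ KD i a b) (hlocD : ∀ i a y'', KD i a y'' ≠ 0 → g.dist a y'' ≤ ρ)
    (hrowD : ∀ i (a : g.Site), ∑ y'' : g.Site, KD i a y'' * g.len y'' ^ 2 ≤ if a ∈ S' i then κΔ else 0)
    (hKQ : ∀ i a b, 0 ≤ KQ i a b) (hlocQ : ∀ i a y'', KQ i a y'' ≠ 0 → g.dist a y'' ≤ ρ)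
    (hrowQ : ∀ i (a : g.Site), ∑ y'' : g.Site, KQ i a y'' * g.len y'' ^ 2 ≤ if a ∈ S' i then κQ else 0)
    (hKC' : ∀ i a b, 0 ≤ KC' i a b) (hlocC' : ∀ i a y'', KC' i a y'' ≠ 0 → g.dist a y'' ≤ ρ)
    (hrowC' : ∀ i (a : g.Site), ∑ y'' : g.Site, KC' i a y'' * g.len y'' ^ 2 ≤
      if a ∈ S' i then κ₄ * g.len a else 0)
    (hdh : ∀ i (v : Bd × Cp), |c v.1 * (hs i (tgt v.1) - hs i (src v.1))| ≤ KC' i (blkY v) (blk (src v.1, v.2)))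
    (hdomSt : ∀ i (p : St × Cp) (y' : g.Site),
      (∑ b ∈ Finset.univ.filter (fun b => src b = p.1 ∧ blkY (b, p.2) = y'),
          |c b * (hs i (tgt b) - hs i (src b))|) +
        (∑ b ∈ Finset.univ.filter (fun b => tgt b = p.1),
          ∑ k ∈ Finset.univ.filter (fun k => blkY (b, k) = y'),
            |c b * (hs i (tgt b) - hs i (src b)) * Rm b k p.2|) ≤ KS i (blk p) y')
    (hdiag : ∀ i (p : St × Cp) (y' : g.Site),
      (if blk p = y' then |slap src tgt c (hs i) p.1| else 0) ≤ KD i (blk p) y')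
    (hsq : ∀ x : St, ∑ i, hs i x ^ 2 = 1)
    {Gsq : ι → Module.End ℝ (St × Cp → ℝ)}
    (h342_1 : ∀ i, HasMajorant (g := toB6 g R H) blk (Gsq i)
      (fun a b => B₀ * g.len a ^ 2 * Real.exp (-(δ₀ * g.dist a b))))
    (h342_2 : ∀ i, HasMajorantHom (g := toB6 g R H) blk blkY (covD src tgt c Rm ∘ₗ Gsq i)
      (fun a b => B₀ * g.len a * Real.exp (-(δ₀ * g.dist a b))))
    (hQ : ∀ i, HasMajorant (g := toB6 g R H) blk (mulOp (hs i ∘ Prod.fst) * Qf - Qf * mulOp (hs i ∘ Prod.fst)) (KQ i))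
    (hloc : ∀ i, mulOp (hs i ∘ Prod.fst) * (covDT src tgt c Rm ∘ₗ covD src tgt c Rm + Qf) * Gsq i *
      mulOp (hs i ∘ Prod.fst) = mulOp (hs i ∘ Prod.fst) * mulOp (hs i ∘ Prod.fst))
    (hinv : G' * (covDT src tgt c Rm ∘ₗ covD src tgt c Rm + Qf) = 1) :
    HasMajorantHom (g := toB6 g R H) blk blkY (covD src tgt c Rm ∘ₗ G')
      (fun (a b : g.Site) => B₀ * (N + N' * Real.exp (δ₀ * ρ) * κ₄) * B6.c1 d δ₀ α *
        (1 - N' * (B₀ * Real.exp (δ₀ * ρ) * (κS + (κΔ + κQ))) * B6.c1 d δ₀ α)⁻¹ * g.len a *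
        Real.exp (-((1 - α) * δ₀ * g.dist a b))) := by
  have hP : ∀ i, HasMajorantHom (g := toB6 g R H) blkY blk
      (leibRemT src tgt c (hs i) + leibRemIn src tgt c Rm (hs i)) (KS i) :=
    fun i => leibRemSt_majorant blk blkY src tgt c Rm (hs i) (KS i) (hdomSt i)
  have hC : ∀ i, HasMajorant (g := toB6 g R H) blk
      (-mulOp (slap src tgt c (hs i) ∘ Prod.fst) + (mulOp (hs i ∘ Prod.fst) * Qf - Qf * mulOp (hs i ∘ Prod.fst)))
      (fun a b => KD i a b + KQ i a b) := fun i =>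
    (hasMajorantHom_iff (g := toB6 g R H) blk _ _).mp
      (hasMajorantHom_add (g := toB6 g R H) blk blk
        (hasMajorantHom_neg blk blk (mulOp_majorant_diag blk (slap src tgt c (hs i) ∘ Prod.fst) (KD i) (hdiag i)))
        ((hasMajorantHom_iff (g := toB6 g R H) blk _ _).mpr (hQ i)))
  have hKC : ∀ i a b, 0 ≤ KD i a b + KQ i a b := fun i a b => add_nonneg (hKD i a b) (hKQ i a b)
  have hlocC : ∀ i a y'', KD i a y'' + KQ i a y'' ≠ 0 → g.dist a y'' ≤ ρ := fun i a y'' hne => by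
    by_cases h1 : KD i a y'' = 0
    · rw [h1, zero_add] at hne
      exact hlocQ i a y'' hne
    · exact hlocD i a y'' h1
  have hrowC : ∀ i (a : g.Site), ∑ y'' : g.Site, (KD i a y'' + KQ i a y'') * g.len y'' ^ 2 ≤
      if a ∈ S' i then κΔ + κQ else 0 := fun i a => rowSum_add_le a (hrowD i a) (hrowQ i a)
  have hκ : 0 ≤ κS + (κΔ + κQ) := by linarith
  exact thm37_entry2_of_342_lattice (P := fun i => leibRemT src tgt c (hs i) + leibRemIn src tgt c Rm (hs i))
    (Cop := fun i => -mulOp (slap src tgt c (hs i) ∘ Prod.fst) +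
      (mulOp (hs i ∘ Prod.fst) * Qf - Qf * mulOp (hs i ∘ Prod.fst)))
    src tgt c Rm blk blkY d δ₀ α ρ B₀ κS (κΔ + κQ) κ₄ N N' S S' hs KS (fun i a b => KD i a b + KQ i a b) KC'
    hB₀ hδ₀ hκ hκ₄ hN hN' hαδ htri hrefl hdnn hlen h261 h263 hsmall hh hSY hcnt hcnt' hKS hlocS hrowS hKC hlocC hrowC
    hKC' hlocC' hrowC' hdh h342_1 h342_2 hP hC hinv (h388_lattice_st src tgt c Rm Qf hs Gsq hRm hsq hloc)

/-- **Theorem 3.7 ⇒ entry 1 of (3.42) for G′ = G′(U) with (3.88) DERIVED in the PRINTED grouping** — v1's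
`thm37_entry1_of_342` with `hP`, `hC`, `h388` DISCHARGED: P_□ = leibRemT h_□ + leibRemIn h_□ (star kernel K_{S,□},
`hdomSt`, κ_S), C_□ = −M_{Δh_□} + [M_{h_□}, Q] (K_{Δ,□}, `hdiag`, κ_Δ; K_Q, `hQ`, κ_Q), `h388_lattice_st`; every other
input as in v1 (Cor. 3.6 entries 1, 2 for the G′_□, |h_□| ≦ 1 and supports, Lemma 2.1 of [4], counts, located
smallness N′B₀e^{δ₀ρ}(κ_S + κ_Δ + κ_Q)c₁(α) < 1). [cite: Balaban1985BackgroundPropagators, Thm 3.7 (3.87)–(3.90) pp.408–410 + (3.42) p.397 + (3.50) p.400; Balaban1984PropagatorsII, Prop 2.2 (2.64)–(2.67) p.234] -/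
theorem thm37_entry1_of_342_lattice_of_387_st [Fintype St] [DecidableEq St] [Fintype Bd] [DecidableEq Bd]
    [Fintype Cp] [DecidableEq Cp]
    (src tgt : Bd → St) (c : Bd → ℝ) (Rm : Bd → Cp → Cp → ℝ) (Qf : Module.End ℝ (St × Cp → ℝ))
    (blk : St × Cp → g.Site) (blkY : Bd × Cp → g.Site) (d : ℕ) (δ₀ α ρ B₀ κS κΔ κQ N N' : ℝ) {ι : Type}
    [Fintype ι] (S S' : ι → Finset g.Site) (hs : ι → St → ℝ) (KS KD KQ : ι → g.Site → g.Site → ℝ)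
    {G' : Module.End ℝ (St × Cp → ℝ)}
    (hRm : ∀ b i j, ∑ k, Rm b k i * Rm b k j = if i = j then 1 else 0)
    (hB₀ : 0 ≤ B₀) (hδ₀ : 0 ≤ δ₀) (hκS : 0 ≤ κS) (hκΔ : 0 ≤ κΔ) (hκQ : 0 ≤ κQ) (hN : 0 ≤ N) (hN' : 0 ≤ N')
    (hαδ : 0 ≤ (1 - α) * δ₀)
    (htri : Triangle254 (toB6 g R H)) (hrefl : ∀ y : g.Site, g.dist y y = 0)
    (hdnn : ∀ y y' : g.Site, 0 ≤ g.dist y y') (hlen : ∀ y : g.Site, 0 ≤ g.len y)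
    (h261 : Ineq261 d (toB6 g R H) δ₀ α) (h263 : Ineq263 d (toB6 g R H) δ₀ α)
    (hsmall : N' * (B₀ * Real.exp (δ₀ * ρ) * (κS + (κΔ + κQ))) * B6.c1 d δ₀ α < 1)
    (hh : ∀ i x, |hs i x| ≤ 1) (hS : ∀ i (p : St × Cp), hs i p.1 ≠ 0 → blk p ∈ S i)
    (hcnt : ∀ a : g.Site, (∑ i, if a ∈ S i then (1 : ℝ) else 0) ≤ N)
    (hcnt' : ∀ a : g.Site, (∑ i, if a ∈ S' i then (1 : ℝ) else 0) ≤ N')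
    (hKS : ∀ i a b, 0 ≤ KS i a b) (hlocS : ∀ i a y'', KS i a y'' ≠ 0 → g.dist a y'' ≤ ρ)
    (hrowS : ∀ i (a : g.Site), ∑ y'' : g.Site, KS i a y'' * g.len y'' ≤ if a ∈ S' i then κS else 0)
    (hKD : ∀ i a b, 0 ≤ KD i a b) (hlocD : ∀ i a y'', KD i a y'' ≠ 0 → g.dist a y'' ≤ ρ)
    (hrowD : ∀ i (a : g.Site), ∑ y'' : g.Site, KD i a y'' * g.len y'' ^ 2 ≤ if a ∈ S' i then κΔ else 0)
    (hKQ : ∀ i a b, 0 ≤ KQ i a b) (hlocQ : ∀ i a y'', KQ i a y'' ≠ 0 → g.dist a y'' ≤ ρ)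
    (hrowQ : ∀ i (a : g.Site), ∑ y'' : g.Site, KQ i a y'' * g.len y'' ^ 2 ≤ if a ∈ S' i then κQ else 0)
    (hdomSt : ∀ i (p : St × Cp) (y' : g.Site),
      (∑ b ∈ Finset.univ.filter (fun b => src b = p.1 ∧ blkY (b, p.2) = y'),
          |c b * (hs i (tgt b) - hs i (src b))|) +
        (∑ b ∈ Finset.univ.filter (fun b => tgt b = p.1),
          ∑ k ∈ Finset.univ.filter (fun k => blkY (b, k) = y'),
            |c b * (hs i (tgt b) - hs i (src b)) * Rm b k p.2|) ≤ KS i (blk p) y')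
    (hdiag : ∀ i (p : St × Cp) (y' : g.Site),
      (if blk p = y' then |slap src tgt c (hs i) p.1| else 0) ≤ KD i (blk p) y')
    (hsq : ∀ x : St, ∑ i, hs i x ^ 2 = 1)
    {Gsq : ι → Module.End ℝ (St × Cp → ℝ)}
    (h342_1 : ∀ i, HasMajorant (g := toB6 g R H) blk (Gsq i)
      (fun a b => B₀ * g.len a ^ 2 * Real.exp (-(δ₀ * g.dist a b))))
    (h342_2 : ∀ i, HasMajorantHom (g := toB6 g R H) blk blkY (covD src tgt c Rm ∘ₗ Gsq i)
      (fun a b => B₀ * g.len a * Real.exp (-(δ₀ * g.dist a b))))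
    (hQ : ∀ i, HasMajorant (g := toB6 g R H) blk (mulOp (hs i ∘ Prod.fst) * Qf - Qf * mulOp (hs i ∘ Prod.fst)) (KQ i))
    (hloc : ∀ i, mulOp (hs i ∘ Prod.fst) * (covDT src tgt c Rm ∘ₗ covD src tgt c Rm + Qf) * Gsq i *
      mulOp (hs i ∘ Prod.fst) = mulOp (hs i ∘ Prod.fst) * mulOp (hs i ∘ Prod.fst))
    (hinv : G' * (covDT src tgt c Rm ∘ₗ covD src tgt c Rm + Qf) = 1) :
    HasMajorant (g := toB6 g R H) blk G'
      (fun (a b : g.Site) => N * B₀ * B6.c1 d δ₀ α *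
        (1 - N' * (B₀ * Real.exp (δ₀ * ρ) * (κS + (κΔ + κQ))) * B6.c1 d δ₀ α)⁻¹ * g.len a ^ 2 *
        Real.exp (-((1 - α) * δ₀ * g.dist a b))) := by
  have hP : ∀ i, HasMajorantHom (g := toB6 g R H) blkY blk
      (leibRemT src tgt c (hs i) + leibRemIn src tgt c Rm (hs i)) (KS i) :=
    fun i => leibRemSt_majorant blk blkY src tgt c Rm (hs i) (KS i) (hdomSt i)
  have hC : ∀ i, HasMajorant (g := toB6 g R H) blk
      (-mulOp (slap src tgt c (hs i) ∘ Prod.fst) + (mulOp (hs i ∘ Prod.fst) * Qf - Qf * mulOp (hs i ∘ Prod.fst)))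
      (fun a b => KD i a b + KQ i a b) := fun i =>
    (hasMajorantHom_iff (g := toB6 g R H) blk _ _).mp
      (hasMajorantHom_add (g := toB6 g R H) blk blk
        (hasMajorantHom_neg blk blk (mulOp_majorant_diag blk (slap src tgt c (hs i) ∘ Prod.fst) (KD i) (hdiag i)))
        ((hasMajorantHom_iff (g := toB6 g R H) blk _ _).mpr (hQ i)))
  have hKC : ∀ i a b, 0 ≤ KD i a b + KQ i a b := fun i a b => add_nonneg (hKD i a b) (hKQ i a b)
  have hlocC : ∀ i a y'', KD i a y'' + KQ i a y'' ≠ 0 → g.dist a y'' ≤ ρ := fun i a y'' hne => by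
    by_cases h1 : KD i a y'' = 0
    · rw [h1, zero_add] at hne
      exact hlocQ i a y'' hne
    · exact hlocD i a y'' h1
  have hrowC : ∀ i (a : g.Site), ∑ y'' : g.Site, (KD i a y'' + KQ i a y'') * g.len y'' ^ 2 ≤
      if a ∈ S' i then κΔ + κQ else 0 := fun i a => rowSum_add_le a (hrowD i a) (hrowQ i a)
  have hκ : 0 ≤ κS + (κΔ + κQ) := by linarith
  exact thm37_entry1_of_342 (P := fun i => leibRemT src tgt c (hs i) + leibRemIn src tgt c Rm (hs i))
    (Cop := fun i => -mulOp (slap src tgt c (hs i) ∘ Prod.fst) +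
      (mulOp (hs i ∘ Prod.fst) * Qf - Qf * mulOp (hs i ∘ Prod.fst)))
    (D := covD src tgt c Rm) blk blkY d δ₀ α ρ B₀ κS (κΔ + κQ) N N' S S' (fun i => hs i ∘ Prod.fst) KS
    (fun i a b => KD i a b + KQ i a b) hB₀ hδ₀ hκ hN hN' hαδ htri hrefl hdnn hlen h261 h263 hsmall
    (fun i x => hh i x.1) (fun i x hx => hS i x hx) hcnt hcnt' hKS hlocS hrowS hKC hlocC hrowC h342_1 h342_2 hP hC
    hinv (h388_lattice_st src tgt c Rm Qf hs Gsq hRm hsq hloc)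

end Entry421St

/-! ## v2 ADDENDUM — entry 3 (G′∇*_U) of (3.42) for G′ in the PRINTED grouping: the transposes of the star
operator and of M_{Δh} (closes the residual named in the v1 docstring; cell record D-pv21g6.2)

p. 391 (verbatim, as quoted in `B9Thm37Glue` v6): *"The adjoints are taken with respect to natural L² scalar products
for functions with values in N × N hermitian matrices"*.  Entry 3 of (3.42) is the RIGHT entry G′∇*_U; the lineage
treats it through TRANSPOSES for the component pairing (`B9Thm37Glue.IsTransposePair`, v6; `B9Thm37GlueT`): the
v6 theorem `thm37_entry3_of_342_lattice_of_388` needs the transposes Pᵗ_□ (sites → bonds) and Cᵗ_□ of the local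
operators of (3.88) with block majorants of COLUMN sums ≦ κ₁1_{S′_□} against L^{j″}η resp. ≦ κ₂1_{S′_□} against
(L^{j″}η)².  For the printed grouping of v1: Pᵗ_□ = (leibRemT h_□ + leibRemIn h_□)ᵗ = leibRem h_□ + leibRemOut h_□
with `leibRemOut h` (this addendum) the transpose of `leibRemIn h` — (leibRemOut h λ)(b, k) = c(b)(h(b₊) − h(b₋))
Σ_i R(U(b))_{ki}λ(b₊, i) = (∂h)(b)(R(U(b))λ(b₊))_k (`isTransposePair_leibRemIn`, kernel) — and Cᵗ_□ =
(−M_{Δh_□} + [M_{h_□}, Q])ᵗ = −M_{Δh_□} + (QM_{h_□} − M_{h_□}Q) for Q symmetric (`isTransposePair_copSt`).  Both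
carry coefficients of the UNIFORM sizes of v1: (∂h)(b) = O((ML^jη)^{−1}) against L^{j″}η (κ₁ = O(M^{−1})) and
(Δh)(x) = O((ML^jη)^{−2}) against (L^{j″}η)² (κ_Δ = O(M^{−2})) — where `B9Thm37GlueT.thm37_entry3_of_342_lattice_of_387`
had Cᵗ_□ ⊇ −(leibRemT h_□)∘D with the non-uniform `hdomLT` (cell GAPS G-pv21g6-1).  The sizes stay NOT asserted.

* `leibRemOut` (+ `_apply`); `isTransposePair_leibRemIn`, `isTransposePair_leibRemSt`, `isTransposePair_copSt`;
* `leibRemOutSt_majorant` — HasMajorantHom blk blkY (leibRem h + leibRemOut h) K from the located entrywise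
  domination `hdhSt` (the b₋-end indicator plus the R-transported b₊-end components, bond component by bond component);
* `thm37_entry3_of_342_lattice_of_387_st` — **Theorem 3.7 ⇒ entry 3 of (3.42) for G′ with (3.88) DERIVED in the
  printed grouping** = `B9Thm37GlueT.thm37_entry3_of_342_lattice_of_387` with P_□, C_□ regrouped: hypotheses `hdhSt`
  (K_P, column sums κ₁ against L^{j″}η), `hdiag` (K_Δ, κ_Δ) and `hQ` (K_Q, κ_Q) against (L^{j″}η)², `hdomT` (K_{C′}, κ₄,
  the outer first-order commutator of ∇*_U with h_□), located smallness N′B₀e^{δ₀ρ}(κ₁ + C_ℓ(κ_Δ + κ_Q))c₁(α) < 1.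

NOT ASSERTED (beyond the v1 list): the symmetry `hQt` of Q = Q′*aQ′ and `hG` of every G′_□ for the component pairing
(print: quadratic-form definitions (3.23)–(3.24) and restricted inverses — no component model of Q′_j(U), G′_□ in
the lineage); Corollary 3.6 entries 1, 3 for the G′_□ (`h342_1`, `h342_3`); the scale comparability `hcomp` (C_ℓ)
and the exponent loss (1 − 2α)δ₀ of the v4 right-entry walk (cell DIVERGENCE D-pv21g5.2); symmetric d, L^{j″}η > 0.
STATE OF THE LINE after v2: all four entries of (3.42) for G′ from Corollary 3.6 for the G′_□ with (3.88) DERIVED in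
the printed grouping and every coefficient kernel of a size uniform in the scale (sizes themselves: GAPS G-pv21g4-1
(i), not displayed in print).  Value: kernel-checked bookkeeping, NOT summit progress. -/

section Entry3St

/-- **The transpose of `leibRemIn h`** for the component pairing: (leibRemOut h λ)(b, k) = c(b)(h(b₊) − h(b₋))
Σ_i R(U(b))_{ki}λ(b₊, i) = (∂h)(b)(R(U(b))λ(b₊))_k — a site-component → bond-component operator (kernel
definition; c, Rm arbitrary). [cite: Balaban1985BackgroundPropagators, (3.88) p.409 + p.391 (L² adjoints)] -/
def leibRemOut [Fintype Cp] (src tgt : Bd → St) (c : Bd → ℝ) (Rm : Bd → Cp → Cp → ℝ) (h : St → ℝ) :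
    (St × Cp → ℝ) →ₗ[ℝ] (Bd × Cp → ℝ) where
  toFun f := fun q => c q.1 * (h (tgt q.1) - h (src q.1)) * ∑ i, Rm q.1 q.2 i * f (tgt q.1, i)
  map_add' f f' := by
    funext q
    simp only [Pi.add_apply, mul_add, Finset.sum_add_distrib]
  map_smul' r f := by
    funext q
    simp only [Pi.smul_apply, smul_eq_mul, RingHom.id_apply, Finset.mul_sum]
    exact Finset.sum_congr rfl fun i _ => by ring

/-- Unfolding equation of `leibRemOut`. [folklore] -/
theorem leibRemOut_apply [Fintype Cp] (src tgt : Bd → St) (c : Bd → ℝ) (Rm : Bd → Cp → Cp → ℝ) (h : St → ℝ)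
    (f : St × Cp → ℝ) (q : Bd × Cp) :
    leibRemOut src tgt c Rm h f q = c q.1 * (h (tgt q.1) - h (src q.1)) * ∑ i, Rm q.1 q.2 i * f (tgt q.1, i) :=
  rfl

/-- **leibRemOut h is the transpose of leibRemIn h** for the component pairing (the R-transported ∂h-kernel at the
heads of the bonds read in both directions; kernel, every c, Rm, h). [folklore] -/
theorem isTransposePair_leibRemIn [Fintype St] [Fintype Bd] [Fintype Cp] [DecidableEq St] (src tgt : Bd → St)
    (c : Bd → ℝ) (Rm : Bd → Cp → Cp → ℝ) (h : St → ℝ) :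
    IsTransposePair (leibRemIn src tgt c Rm h) (leibRemOut src tgt c Rm h) := by
  intro u v
  calc ∑ p, leibRemIn src tgt c Rm h u p * v p
      = ∑ p : St × Cp, ∑ b, (if tgt b = p.1 then c b * (h (tgt b) - h (src b)) else 0) *
          (∑ k, Rm b k p.2 * u (b, k)) * v p := by
        refine Finset.sum_congr rfl fun p _ => ?_
        rw [leibRemIn_apply, Finset.sum_mul]
    _ = ∑ b, ∑ p : St × Cp, (if tgt b = p.1 then c b * (h (tgt b) - h (src b)) else 0) *
          (∑ k, Rm b k p.2 * u (b, k)) * v p := Finset.sum_comm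
    _ = ∑ b, ∑ i : Cp, c b * (h (tgt b) - h (src b)) * (∑ k, Rm b k i * u (b, k)) * v (tgt b, i) := by
        refine Finset.sum_congr rfl fun b _ => ?_
        rw [Fintype.sum_prod_type, Finset.sum_comm]
        refine Finset.sum_congr rfl fun i _ => ?_
        rw [Finset.sum_eq_single (tgt b)]
        · simp
        · intro x _ hx
          rw [if_neg (Ne.symm hx), zero_mul, zero_mul]
        · intro hx
          exact absurd (Finset.mem_univ _) hx
    _ = ∑ b, ∑ k : Cp, u (b, k) * (c b * (h (tgt b) - h (src b)) * ∑ i, Rm b k i * v (tgt b, i)) := by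
        refine Finset.sum_congr rfl fun b _ => ?_
        calc ∑ i, c b * (h (tgt b) - h (src b)) * (∑ k, Rm b k i * u (b, k)) * v (tgt b, i)
            = ∑ i, ∑ k, c b * (h (tgt b) - h (src b)) * (Rm b k i * u (b, k)) * v (tgt b, i) := by
              refine Finset.sum_congr rfl fun i _ => ?_
              rw [Finset.mul_sum, Finset.sum_mul]
          _ = ∑ k, ∑ i, c b * (h (tgt b) - h (src b)) * (Rm b k i * u (b, k)) * v (tgt b, i) := Finset.sum_comm
          _ = ∑ k, u (b, k) * (c b * (h (tgt b) - h (src b)) * ∑ i, Rm b k i * v (tgt b, i)) := by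
              refine Finset.sum_congr rfl fun k _ => ?_
              rw [Finset.mul_sum, Finset.mul_sum]
              exact Finset.sum_congr rfl fun i _ => by ring
    _ = ∑ q : Bd × Cp, u q * leibRemOut src tgt c Rm h v q := by
        rw [Fintype.sum_prod_type]
        rfl

/-- **The transpose of the star operator**: (leibRemT h + leibRemIn h)ᵗ = leibRem h + leibRemOut h — the datum `hP`
of v6's `thm37_entry3_of_342_lattice_of_388` for the printed grouping. [folklore] -/
theorem isTransposePair_leibRemSt [Fintype St] [Fintype Bd] [Fintype Cp] [DecidableEq St] (src tgt : Bd → St)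
    (c : Bd → ℝ) (Rm : Bd → Cp → Cp → ℝ) (h : St → ℝ) :
    IsTransposePair (leibRemT src tgt c h + leibRemIn src tgt c Rm h)
      (leibRem src tgt c h + leibRemOut src tgt c Rm h) :=
  (isTransposePair_leibRemT src tgt c h).add (isTransposePair_leibRemIn src tgt c Rm h)

/-- **The transpose of the concrete C_□ of the printed grouping**: for Q SYMMETRIC for the component pairing
(`hQt`; print: Q′*aQ′ defined by the quadratic form (3.24), p. 394), (−M_{Δh} + [M_h, Q])ᵗ = −M_{Δh} + (QM_h − M_hQ)
— the datum `hC` of v6's `thm37_entry3_of_342_lattice_of_388`. [folklore] -/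
theorem isTransposePair_copSt [Fintype St] [Fintype Bd] [Fintype Cp] [DecidableEq St] (src tgt : Bd → St)
    (c : Bd → ℝ) {Qf : Module.End ℝ (St × Cp → ℝ)} (hQt : IsTransposePair Qf Qf) (h : St → ℝ) :
    IsTransposePair
      (-mulOp (slap src tgt c h ∘ Prod.fst) + (mulOp (h ∘ Prod.fst) * Qf - Qf * mulOp (h ∘ Prod.fst)))
      (-mulOp (slap src tgt c h ∘ Prod.fst) + (Qf * mulOp (h ∘ Prod.fst) - mulOp (h ∘ Prod.fst) * Qf)) :=
  (isTransposePair_neg (isTransposePair_mulOp _)).add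
    (((isTransposePair_mulOp _).mul hQt).sub (hQt.mul (isTransposePair_mulOp _)))

/-- **Block majorant of Pᵗ_□ = leibRem h + leibRemOut h** (sites → bonds) from the located ENTRYWISE domination
`hdhSt`: for the bond component (b, k) and a site block y′, 1_{(b₋, k) in block y′}|c(b)(∂̃h)(b)| + Σ_{i : (b₊, i) in
block y′}|c(b)(∂̃h)(b)R(U(b))_{ki}| ≦ K(y_b, y′), y_b the bond block of (b, k), (∂̃h)(b) = h(b₊) − h(b₋) — the datum
`hPt` of v6's theorem (COLUMN sums of K against L^{j″}η are what is summed; the SIZE O((ML^jη)^{−1}) of the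
coefficients is carried by K and not displayed in print). [cite: Balaban1985BackgroundPropagators, (3.88)–(3.89) p.409; Balaban1984PropagatorsII, (2.39)–(2.40) pp.229–230] -/
theorem leibRemOutSt_majorant [Fintype Cp] (blk : St × Cp → g.Site) (blkY : Bd × Cp → g.Site)
    (src tgt : Bd → St) (c : Bd → ℝ) (Rm : Bd → Cp → Cp → ℝ) (h : St → ℝ) (K : g.Site → g.Site → ℝ)
    (hdhSt : ∀ (v : Bd × Cp) (y' : g.Site),
      (if blk (src v.1, v.2) = y' then |c v.1 * (h (tgt v.1) - h (src v.1))| else 0) +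
        (∑ i ∈ Finset.univ.filter (fun i => blk (tgt v.1, i) = y'),
          |c v.1 * (h (tgt v.1) - h (src v.1)) * Rm v.1 v.2 i|) ≤ K (blkY v) y') :
    HasMajorantHom (g := toB6 g R H) blk blkY (leibRem src tgt c h + leibRemOut src tgt c Rm h) K := by
  intro y' μ B hμ v
  rw [LinearMap.add_apply, Pi.add_apply]
  refine (abs_add_le _ _).trans ?_
  have h1 : |leibRem src tgt c h μ v| ≤
      (if blk (src v.1, v.2) = y' then |c v.1 * (h (tgt v.1) - h (src v.1))| else 0) * B := by
    rw [leibRem_apply, abs_mul]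
    by_cases hb : blk (src v.1, v.2) = y'
    · rw [if_pos hb]
      exact mul_le_mul_of_nonneg_left (hμ.bound _ hb) (abs_nonneg _)
    · rw [if_neg hb, hμ.off _ hb, abs_zero, mul_zero, zero_mul]
  have h2 : |leibRemOut src tgt c Rm h μ v| ≤
      (∑ i ∈ Finset.univ.filter (fun i => blk (tgt v.1, i) = y'),
        |c v.1 * (h (tgt v.1) - h (src v.1)) * Rm v.1 v.2 i|) * B := by
    rw [leibRemOut_apply, Finset.mul_sum]
    refine (Finset.abs_sum_le_sum_abs _ _).trans ?_
    calc ∑ i, |c v.1 * (h (tgt v.1) - h (src v.1)) * (Rm v.1 v.2 i * μ (tgt v.1, i))|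
        ≤ ∑ i, (if blk (tgt v.1, i) = y' then |c v.1 * (h (tgt v.1) - h (src v.1)) * Rm v.1 v.2 i| * B else 0) := by
          refine Finset.sum_le_sum fun i _ => ?_
          by_cases hi : blk (tgt v.1, i) = y'
          · rw [if_pos hi, show c v.1 * (h (tgt v.1) - h (src v.1)) * (Rm v.1 v.2 i * μ (tgt v.1, i)) =
                (c v.1 * (h (tgt v.1) - h (src v.1)) * Rm v.1 v.2 i) * μ (tgt v.1, i) by ring, abs_mul]
            exact mul_le_mul_of_nonneg_left (hμ.bound _ hi) (abs_nonneg _)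
          · rw [if_neg hi, hμ.off _ hi, mul_zero, mul_zero, abs_zero]
      _ = (∑ i ∈ Finset.univ.filter (fun i => blk (tgt v.1, i) = y'),
            |c v.1 * (h (tgt v.1) - h (src v.1)) * Rm v.1 v.2 i|) * B := by
          rw [Finset.sum_filter, Finset.sum_mul]
          exact Finset.sum_congr rfl fun i _ => by split_ifs <;> simp
  refine (add_le_add h1 h2).trans ?_
  rw [← add_mul]
  exact mul_le_mul_of_nonneg_right (hdhSt v y') hμ.nonneg

/-- **Theorem 3.7 ⇒ entry 3 of (3.42) for G′ = G′(U) (G′∇*_U) with (3.88) DERIVED in the PRINTED grouping** —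
v6's `thm37_entry3_of_342_lattice_of_388` with `h388`, `hP`, `hC`, `hΔ` DISCHARGED: Δ′_a := D*D + Q with Q SYMMETRIC
(`hQt`), P_□ = leibRemT h_□ + leibRemIn h_□ (Pᵗ_□ = leibRem h_□ + leibRemOut h_□, majorant K_P from the entrywise
domination `hdhSt`, column sums ≦ κ₁1_{S′_□} against L^{j″}η), C_□ = −M_{Δh_□} + [M_{h_□}, Q] (Cᵗ_□ = −M_{Δh_□} +
(QM_{h_□} − M_{h_□}Q), majorant K_Δ + K_Q from `hdiag` and the commutator HYPOTHESIS `hQ`, column sums ≦ (κ_Δ +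
κ_Q)1_{S′_□} against (L^{j″}η)²), (3.88) from `hloc` + `hsq` (`h388_lattice_st`).  Remaining print inputs exactly as
in `B9Thm37GlueT.thm37_entry3_of_342_lattice_of_387`: Corollary 3.6 entries 1, 3 for the G′_□, the symmetry `hG` of
the G′_□, G′Δ′_a = I, `hdomT` (K_{C′}, κ₄: the outer first-order commutator), the scale comparability `hcomp` (C_ℓ),
Lemma 2.1 of [4], counts, located smallness N′B₀e^{δ₀ρ}(κ₁ + C_ℓ(κ_Δ + κ_Q))c₁(α) < 1, 0 ≦ αδ₀, 0 ≦ (1 − 2α)δ₀.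
[cite: Balaban1985BackgroundPropagators, Thm 3.7 (3.87)–(3.90) pp.408–410 + (3.42) p.397 + (3.23)–(3.24) p.394 + (3.50) p.400 + p.391; Balaban1984PropagatorsII, Prop 2.2 (2.67) p.234] -/
theorem thm37_entry3_of_342_lattice_of_387_st [Fintype St] [DecidableEq St] [Fintype Cp] [DecidableEq Cp]
    [Fintype Bd] [DecidableEq Bd] (blk : St × Cp → g.Site) (blkY : Bd × Cp → g.Site) (src tgt : Bd → St)
    (c : Bd → ℝ) (Rm : Bd → Cp → Cp → ℝ) (Qf : Module.End ℝ (St × Cp → ℝ)) (d : ℕ)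
    (δ₀ α ρ B₀ κ₁ κΔ κQ κ₄ Cℓ N N' : ℝ) {ι : Type} [Fintype ι]
    (S S' : ι → Finset g.Site) (hs : ι → St → ℝ) (KP KD KQ KC' : ι → g.Site → g.Site → ℝ)
    {G' : Module.End ℝ (St × Cp → ℝ)}
    (hRm : ∀ b i j, ∑ k, Rm b k i * Rm b k j = if i = j then 1 else 0)
    (hB₀ : 0 ≤ B₀) (hδ₀ : 0 ≤ δ₀) (hκ₁ : 0 ≤ κ₁) (hκΔ : 0 ≤ κΔ) (hκQ : 0 ≤ κQ) (hκ₄ : 0 ≤ κ₄) (hCℓ : 0 ≤ Cℓ)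
    (hN : 0 ≤ N) (hN' : 0 ≤ N') (hαδ : 0 ≤ α * δ₀) (hαδ2 : 0 ≤ (1 - 2 * α) * δ₀)
    (htri : Triangle254 (toB6 g R H)) (hrefl : ∀ y : g.Site, g.dist y y = 0)
    (hsym : ∀ y y' : g.Site, g.dist y y' = g.dist y' y) (hdnn : ∀ y y' : g.Site, 0 ≤ g.dist y y')
    (hlenpos : ∀ y : g.Site, 0 < g.len y)
    (h261 : Ineq261 d (toB6 g R H) δ₀ α) (h263 : Ineq263 d (toB6 g R H) δ₀ α)
    (hsmall : N' * (B₀ * Real.exp (δ₀ * ρ) * (κ₁ + Cℓ * (κΔ + κQ))) * B6.c1 d δ₀ α < 1)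
    (hh : ∀ i x, |hs i x| ≤ 1) (hS : ∀ i (p : St × Cp), hs i p.1 ≠ 0 → blk p ∈ S i)
    (hcnt : ∀ a : g.Site, (∑ i, if a ∈ S i then (1 : ℝ) else 0) ≤ N)
    (hcnt' : ∀ b : g.Site, (∑ i, if b ∈ S' i then (1 : ℝ) else 0) ≤ N')
    (hcomp : ∀ i (a b : g.Site), a ∈ S i → b ∈ S' i → g.len a ≤ Cℓ * g.len b)
    (hKP : ∀ i a b, 0 ≤ KP i a b) (hlocP : ∀ i y'' b, KP i y'' b ≠ 0 → g.dist y'' b ≤ ρ)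
    (hcolP : ∀ i (b : g.Site), (∑ y'' : g.Site, KP i y'' b) * g.len b ≤ if b ∈ S' i then κ₁ else 0)
    (hKD : ∀ i a b, 0 ≤ KD i a b) (hlocD : ∀ i y'' b, KD i y'' b ≠ 0 → g.dist y'' b ≤ ρ)
    (hcolD : ∀ i (b : g.Site), (∑ y'' : g.Site, KD i y'' b) * g.len b ^ 2 ≤ if b ∈ S' i then κΔ else 0)
    (hKQ : ∀ i a b, 0 ≤ KQ i a b) (hlocQ : ∀ i y'' b, KQ i y'' b ≠ 0 → g.dist y'' b ≤ ρ)
    (hcolQ : ∀ i (b : g.Site), (∑ y'' : g.Site, KQ i y'' b) * g.len b ^ 2 ≤ if b ∈ S' i then κQ else 0)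
    (hKC' : ∀ i a b, 0 ≤ KC' i a b) (hlocC' : ∀ i y'' b, KC' i y'' b ≠ 0 → g.dist y'' b ≤ ρ)
    (hcolC' : ∀ i (b : g.Site), (∑ y'' : g.Site, KC' i y'' b) * g.len b ≤ if b ∈ S' i then κ₄ else 0)
    (hdomT : ∀ i (p : St × Cp) (y' : g.Site),
      ∑ b ∈ Finset.univ.filter (fun b => src b = p.1 ∧ blkY (b, p.2) = y'), |c b * (hs i (tgt b) - hs i (src b))| ≤
        KC' i (blk p) y')
    (hdhSt : ∀ i (v : Bd × Cp) (y' : g.Site),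
      (if blk (src v.1, v.2) = y' then |c v.1 * (hs i (tgt v.1) - hs i (src v.1))| else 0) +
        (∑ k ∈ Finset.univ.filter (fun k => blk (tgt v.1, k) = y'),
          |c v.1 * (hs i (tgt v.1) - hs i (src v.1)) * Rm v.1 v.2 k|) ≤ KP i (blkY v) y')
    (hdiag : ∀ i (p : St × Cp) (y' : g.Site),
      (if blk p = y' then |slap src tgt c (hs i) p.1| else 0) ≤ KD i (blk p) y')
    (hsq : ∀ x : St, ∑ i, hs i x ^ 2 = 1)
    {Gsq : ι → Module.End ℝ (St × Cp → ℝ)}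
    (h342_1 : ∀ i, HasMajorant (g := toB6 g R H) blk (Gsq i)
      (fun a b => B₀ * g.len a ^ 2 * Real.exp (-(δ₀ * g.dist a b))))
    (h342_3 : ∀ i, HasMajorantHom (g := toB6 g R H) blkY blk (Gsq i ∘ₗ covDT src tgt c Rm)
      (fun a b => B₀ * g.len a * Real.exp (-(δ₀ * g.dist a b))))
    (hQ : ∀ i, HasMajorant (g := toB6 g R H) blk (mulOp (hs i ∘ Prod.fst) * Qf - Qf * mulOp (hs i ∘ Prod.fst)) (KQ i))
    (hQt : IsTransposePair Qf Qf) (hG : ∀ i, IsTransposePair (Gsq i) (Gsq i))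
    (hloc : ∀ i, mulOp (hs i ∘ Prod.fst) * (covDT src tgt c Rm ∘ₗ covD src tgt c Rm + Qf) * Gsq i *
      mulOp (hs i ∘ Prod.fst) = mulOp (hs i ∘ Prod.fst) * mulOp (hs i ∘ Prod.fst))
    (hinv : G' * (covDT src tgt c Rm ∘ₗ covD src tgt c Rm + Qf) = 1) :
    HasMajorantHom (g := toB6 g R H) blkY blk (G' ∘ₗ covDT src tgt c Rm)
      (fun (a b : g.Site) => B₀ * (N + N' * Real.exp (δ₀ * ρ) * Cℓ * κ₄) * B6.c1 d δ₀ α *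
        (1 - N' * (B₀ * Real.exp (δ₀ * ρ) * (κ₁ + Cℓ * (κΔ + κQ))) * B6.c1 d δ₀ α)⁻¹ * g.len a *
        Real.exp (-((1 - 2 * α) * δ₀ * g.dist a b))) := by
  have hPt : ∀ i, HasMajorantHom (g := toB6 g R H) blk blkY
      (leibRem src tgt c (hs i) + leibRemOut src tgt c Rm (hs i)) (KP i) :=
    fun i => leibRemOutSt_majorant blk blkY src tgt c Rm (hs i) (KP i) (hdhSt i)
  have hQ' : ∀ i, HasMajorant (g := toB6 g R H) blk
      (Qf * mulOp (hs i ∘ Prod.fst) - mulOp (hs i ∘ Prod.fst) * Qf) (KQ i) := fun i => by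
    rw [← neg_sub]
    exact (hasMajorantHom_iff (g := toB6 g R H) blk _ _).mp
      (hasMajorantHom_neg blk blk ((hasMajorantHom_iff (g := toB6 g R H) blk _ _).mpr (hQ i)))
  have hCt : ∀ i, HasMajorant (g := toB6 g R H) blk
      (-mulOp (slap src tgt c (hs i) ∘ Prod.fst) + (Qf * mulOp (hs i ∘ Prod.fst) - mulOp (hs i ∘ Prod.fst) * Qf))
      (fun a b => KD i a b + KQ i a b) := fun i =>
    (hasMajorantHom_iff (g := toB6 g R H) blk _ _).mp
      (hasMajorantHom_add (g := toB6 g R H) blk blk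
        (hasMajorantHom_neg blk blk (mulOp_majorant_diag blk (slap src tgt c (hs i) ∘ Prod.fst) (KD i) (hdiag i)))
        ((hasMajorantHom_iff (g := toB6 g R H) blk _ _).mpr (hQ' i)))
  have hKC : ∀ i a b, 0 ≤ KD i a b + KQ i a b := fun i a b => add_nonneg (hKD i a b) (hKQ i a b)
  have hlocC : ∀ i y'' b, KD i y'' b + KQ i y'' b ≠ 0 → g.dist y'' b ≤ ρ := fun i y'' b hne => by
    by_cases h1 : KD i y'' b = 0
    · rw [h1, zero_add] at hne
      exact hlocQ i y'' b hne
    · exact hlocD i y'' b h1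
  have hcolC : ∀ i (b : g.Site), (∑ y'' : g.Site, (KD i y'' b + KQ i y'' b)) * g.len b ^ 2 ≤
      if b ∈ S' i then κΔ + κQ else 0 := fun i b => colSum_add_le b (hcolD i b) (hcolQ i b)
  exact thm37_entry3_of_342_lattice_of_388
    (P := fun i => leibRemT src tgt c (hs i) + leibRemIn src tgt c Rm (hs i))
    (Cop := fun i => -mulOp (slap src tgt c (hs i) ∘ Prod.fst) +
      (mulOp (hs i ∘ Prod.fst) * Qf - Qf * mulOp (hs i ∘ Prod.fst)))
    (Pt := fun i => leibRem src tgt c (hs i) + leibRemOut src tgt c Rm (hs i))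
    (Ct := fun i => -mulOp (slap src tgt c (hs i) ∘ Prod.fst) +
      (Qf * mulOp (hs i ∘ Prod.fst) - mulOp (hs i ∘ Prod.fst) * Qf))
    blk blkY src tgt c Rm d δ₀ α ρ B₀ κ₁ (κΔ + κQ) κ₄ Cℓ N N' S S' hs KP (fun i a b => KD i a b + KQ i a b) KC'
    hB₀ hδ₀ hκ₁ (add_nonneg hκΔ hκQ) hκ₄ hCℓ hN hN' hαδ hαδ2 htri hrefl hsym hdnn hlenpos h261 h263 hsmall hh hS
    hcnt hcnt' hcomp hKP hlocP hcolP hKC hlocC hcolC hKC' hlocC' hcolC' hdomT h342_1 h342_3 hPt hCt hinv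
    ((isTransposePair_covLap src tgt c Rm).add hQt) hG (fun i => isTransposePair_leibRemSt src tgt c Rm (hs i))
    (fun i => isTransposePair_copSt src tgt c hQt (hs i)) (h388_lattice_st src tgt c Rm Qf hs Gsq hRm hsq hloc)

end Entry3St

end Literature.MathematicalPhysics.QuantumFieldTheory.Balaban1983to89.B9Thm37GlueSt
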